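import Literature.MathematicalPhysics.QuantumManyBody.NeumannScatteringEigenvalue
import Literature.MathematicalPhysics.QuantumManyBody.PeriodicBoseGasScatteringSolution
import HarnessLib

/-!
# The Neumann scattering problem on a ball, II: the ground state `f_ℓ`, `0 ≤ f_ℓ ≤ 1`,
# `∫Vf_ℓ = 8π𝔞 + O(ℓ⁻¹)` and the pointwise bounds `w_ℓ ≤ C/(|x|+1)`, `|∇w_ℓ| ≤ C/(x²+1)`

Topic `Literature/MathematicalPhysics/QuantumManyBody`, namespace `BoseGas` (provefact
`Literature.MathematicalPhysics.QuantumManyBody.BoseGas.BastiCenatiempoSchlein2021_upperBound`, via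
`…BCS2021_lhyUpperBound_dirichlet`; third file of the first-quantised input
[BastiCenatiempoSchlein2021, Lemma 2.1] = [BoccatoEtAl2019, Lemma 4.1] = [ErdosSchleinYau2006,
Lemma A.1] of Prop. 1.3, on top of `RadialVolterraEquation.lean` (the regular radial solution
`m_E = volterraSol (neumannCoeff V E)` of `-m'' + ½Vm = Em`, `m(0) = 0`, `m'(0) = 1`) and
`NeumannScatteringEigenvalue.lean` (the lowest Neumann eigenvalue `λ = neumannEigenvalue V L` on the
ball of radius `L`, `L m_λ'(L) = m_λ(L)`, Lemma 2.1 (i) `|λ - 3a/L³| ≤ 55R²/L⁴`).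

Setting as there: `V : ℝ → [0, ∞]` a measurable radial profile of range `R > 0`
(`V(r) = 0` for `r > R`) with `K = ∫₀^∞ V³s² < ∞` (i.e. `V(|x|) ∈ L³(ℝ³)`, unbounded potentials
allowed); `a = volterraScatteringLength V R = R - u(R)/u'(R)` (`u = m₀`) is the scattering length of
`½V` in the radial normalisation (`8πa = ∫ V f₀`). The radius of the ball is called `L` (it is
`N^{1-κ}ℓ` in [BastiCenatiempoSchlein2021, (2.4)] and `Nℓ` in [BoccatoEtAl2019, (4.1)]); all
thresholds and constants below are explicit in `R`, `K` and `u'(R)`.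

[BastiCenatiempoSchlein2021, (2.4)]: `f_ℓ` is the lowest-energy solution of the Neumann problem
`[-Δ + ½V]f_ℓ = λ_ℓ f_ℓ` on `|x| ≤ L` normalised by `f_ℓ = 1` on `|x| = L`, extended by `1`;
`w_ℓ = 1 - f_ℓ`. In radial form `f_ℓ(r) = m_λ(r)/(c r)` with `c = m_λ(L)/L` (`neumannNorm`,
`neumannProfile`); the Neumann condition is `f_ℓ'(L) = 0`.

## Main results (all for `L ≥ L₀ = neumannThreshold V R`, resp. `L ≥ L₀' = profileThreshold V R`)

* positivity and size of the ground state: `groundRadial_ge_inside` (`m_λ ≥ ¾r` on `[0, R]`),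
  `groundRadial_ge` (`m_λ ≥ r/2` on `[0, L]`), `groundNorm_bounds`, `groundNorm_le`
  (`½ ≤ c ≤ (18/17)(u'(R) + ¼)`);
* the flux `J = r m_λ' - m_λ` (`= λ∫_r^L s m_λ` beyond the range, `flux_ground_outside`; `J(L) = 0`),
  the profile `F = m_λ/r` with `F' = J/r²` (`hasDerivAt_profile`), `F` non-decreasing on `[R, L]`
  (`profile_monotoneOn_outside`) with the gap `F(L) - F(R) ≥ λL³/(12R)` (`profile_gap`);
* **the radial maximum principle** `groundRadial_le_norm_mul`: `m_λ(r) ≤ c r` on `(0, L]`, i.e.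
  `f_ℓ ≤ 1` — outside by monotonicity of `F`, inside by the comparison `profile_inside_le`
  (`F(ρ) ≤ F(R) + λM(R² - ρ²)/6` whenever `m_λ ≤ Mt` on `(0, R]`) bootstrapped against the gap
  (this replaces the Harnack/maximum-principle argument of [ErdosSchleinYau2006, Lemma A.1 (ii)]);
* `ground_data_le` (`0 ≤ m_λ(R) ≤ R m_λ'(R)`), `integral_pot_ground_eq` (the total flux vanishes:
  `∫₀ᴸ sVm_λ = 2λ∫₀ᴸ s m_λ`, [BoccatoEtAl2019, App. B: "the first contribution vanishes"]),
  `abs_aE_sub_a_mul_le` (`|a_λ - a| ≤ (16/3)R²/L`, `a_λ = R - m_λ(R)/m_λ'(R)`),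
  `abs_flux_ratio_sub_scatteringLength_le` (`|λI/c - a| ≤ 9R²/L`, `I = ∫₀ᴸ s m_λ`);
* `neumannNorm`, `neumannProfile` (`f_ℓ`), `neumannFlux`, `neumannProfileDeriv` and
  **Lemma 2.1 (ii)**: `neumannProfile_mem_Icc` (`0 ≤ f_ℓ ≤ 1`), `neumannProfile_of_ge` (`f_ℓ = 1`
  from `L` on), `abs_integral_sq_pot_neumannProfile_sub_le`
  (**`|∫₀^∞ s²Vf_ℓ - 2a| ≤ 18R²/L`**, i.e. `|∫_{ℝ³}Vf_ℓ - 8πa| ≤ 72πR²/L`);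
* **Lemma 2.1 (iii)**: `one_sub_neumannProfile_mem` (**`0 ≤ w_ℓ(r) ≤ (2R+1)/(r+1)`**),
  `hasDerivAt_neumannProfile` (`f_ℓ` is `C¹` on `(0, ∞)`, `f_ℓ'(L) = 0`),
  `abs_neumannProfileDeriv_inside_le` (`|f_ℓ'| ≤ K/6 + 1/8` on `(0, R]`),
  `neumannProfileDeriv_outside_mem` (`0 ≤ f_ℓ' ≤ 5R/(3r²)` on `[R, ∞)`),
  `abs_neumannProfileDeriv_le` (**`|f_ℓ'(r)| ≤ C/(r² + 1)`**, `C = (K/6 + 1/8)(R²+1) + 2(R + R⁻¹)`);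
  continuity on `[0, ∞)` (`continuousOn_neumannProfile`, `f_ℓ(0) = 1/c`);
* `neumannProfile_spec` — the qualitative summary `∃ L₀ C, ∀ L ≥ L₀, …` of Lemma 2.1 (ii)–(iii);
* **`a = scatteringLength V`** (`volterraScatteringLength_eq_toReal_scatteringLength`): under the
  extra assumption `∫_{ℝ³} V(|x|) dx < ∞` of the tree's scattering theory, the radial scattering
  length `R - u(R)/u'(R)` IS the variational scattering length `scatteringLength V` of
  `PeriodicBoseGas.lean` [LSSY2005, Thm. C.1] — both are limits over the bounded truncations
  `min(V, N)` (`toReal_scatteringLength_eq_iSup` of `PeriodicBoseGasScatteringSolution.lean`,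
  `odeScatteringLength_eq_volterra`, and dominated convergence in the Lipschitz dependence of the
  Volterra solution on its coefficient: `tendsto_integral_trunc_sub`, `tendsto_zeroEnergy_data_trunc`,
  `tendsto_volterraScatteringLength_trunc`); hence Lemma 2.1 (i)–(ii) with the paper's `𝔞`:
  `abs_neumannEigenvalue_sub_scatteringLength_le` (`|λ_ℓ - 3𝔞/L³| ≤ 55R²/L⁴`) and
  `abs_integral_sq_pot_neumannProfile_sub_scatteringLength_le` (`|∫₀^∞ s²Vf_ℓ - 2𝔞| ≤ 18R²/L`).

Not here: the three-dimensional repackaging (`f_N(x) = f_ℓ(N^{1-κ}|x|)`, the distributional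
equation (2.5) on `Λ`, the Fourier bound (iv) `|ŵ_N(p)| ≤ C/(N^{1-κ}p²)`).
No named facts; all definitions are real.

## References

* [BastiCenatiempoSchlein2021] G. Basti, S. Cenatiempo, B. Schlein, *A new second-order upper bound
  for the ground state energy of dilute Bose gases*, Forum Math. Sigma 9 (2021) e74
  (arXiv:2101.06222), (2.4)–(2.6) and Lemma 2.1 (ii)–(iii) (arXiv p. 6).
* [BoccatoEtAl2019] C. Boccato, C. Brennecke, S. Cenatiempo, B. Schlein, *Optimal rate for
  Bose–Einstein condensation in the Gross–Pitaevskii regime*, Commun. Math. Phys. 376 (2020)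
  (arXiv:1812.03086), Lemma 4.1 (ii)–(iii), (4.6)–(4.7), and App. B (arXiv pp. 12, 42):
  `f(r) = m(r)/r`, the flux identity, `|f'(r)| ≤ C(‖V‖₃ + 1)` inside and `≤ C/(r²+1)` outside.
* [ErdosSchleinYau2006] L. Erdős, B. Schlein, H.-T. Yau, *Derivation of the Gross–Pitaevskii
  hierarchy for the dynamics of Bose–Einstein condensate*, Comm. Pure Appl. Math. 59 (2006)
  (arXiv:math-ph/0410005), App. A, Lemma A.1 (ii) with (A.2) (arXiv pp. 35–36): `0 ≤ 1 - φ ≤ Ca/(r+a)`,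
  `|∇φ| ≤ Ca/(r+a)²`.
* [LSSY2005] E. H. Lieb, R. Seiringer, J. P. Solovej, J. Yngvason, *The Mathematics of the Bose Gas
  and its Condensation* (2005), (2.4)–(2.5) (`|m(r) - r| ≤ r(e^{G(r)} - 1)`).
-/

noncomputable section

open MeasureTheory Set Filter Topology
open scoped ENNReal NNReal BigOperators Nat

namespace Literature.MathematicalPhysics.QuantumManyBody.BoseGas

/-! ### The Neumann ground state `m_λ` on the window: positivity and the data at `L` -/

section GroundRadial

variable {V : ℝ → ℝ≥0∞} {R : ℝ}

/-- Taylor lower bounds on `[0, ½]`: `cos y ≥ 13/15` and `sinc y ≥ 19/20` for `0 ≤ y ≤ ½`. [folklore] -/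
theorem cos_sinc_lower_of_le_half {y : ℝ} (hy0 : 0 ≤ y) (hy : y ≤ 1 / 2) :
    13 / 15 ≤ Real.cos y ∧ 19 / 20 ≤ Real.sinc y ∧ Real.cos y ≤ 1 ∧ Real.sinc y ≤ 1 := by
  have hyabs : |y| ≤ 1 := by rw [abs_of_nonneg hy0]; linarith
  have hc := abs_le.1 (abs_cos_sub_le hyabs)
  have hs := abs_le.1 (abs_sinc_sub_le hyabs)
  have hy2 : y ^ 2 ≤ 1 / 4 := by nlinarith
  have hy4 : y ^ 4 ≤ 1 / 16 := by nlinarith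
  exact ⟨by nlinarith [hc.1], by nlinarith [hs.1], Real.cos_le_one y, Real.sinc_le_one y⟩

/-- Second-order Taylor bounds on `[0, ½]`: `|cos y - 1| ≤ 0.52 y²`, `|sinc y - 1| ≤ 0.2 y²`. [folklore] -/
theorem abs_cos_sub_one_le {y : ℝ} (hy0 : 0 ≤ y) (hy : y ≤ 1 / 2) :
    |Real.cos y - 1| ≤ 13 / 25 * y ^ 2 ∧ |Real.sinc y - 1| ≤ 1 / 5 * y ^ 2 := by
  have hyabs : |y| ≤ 1 := by rw [abs_of_nonneg hy0]; linarith
  have hc := abs_le.1 (abs_cos_sub_le hyabs)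
  have hs := abs_le.1 (abs_sinc_sub_le hyabs)
  have hy2 : y ^ 2 ≤ 1 / 4 := by nlinarith
  have hy4 : y ^ 4 ≤ y ^ 2 / 4 := by nlinarith
  constructor
  · rw [abs_le]; constructor <;> nlinarith [hc.1, hc.2]
  · rw [abs_le]; constructor <;> nlinarith [hs.1, hs.2]

variable (hV : Measurable V) (hV3 : ∫⁻ s in Ioi (0 : ℝ), ENNReal.ofReal (s ^ 2) * V s ^ 3 ≠ ⊤)
  (hR : 0 < R) (hVR : ∀ r, R < r → V r = 0)
include hV hV3 hR hVR

/-- **The ground state is positive inside the range**: `m_λ(r) ≥ ¾ r` on `[0, R]` for `L ≥ L₀`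
(`u(r) ≥ r` and `|m_λ - u| ≤ C₁λr ≤ r/4`). [cite: ErdosSchleinYau2006, Lemma A.1 (ii)] -/
theorem groundRadial_ge_inside {L : ℝ} (hL : neumannThreshold V R ≤ L) {r : ℝ} (hr : r ∈ Icc 0 R) :
    3 / 4 * r ≤ volterraSol (neumannCoeff V (neumannEigenvalue V L)) r := by
  obtain ⟨hl0, hl1, -, -⟩ := neumannEigenvalue_spec hV hV3 hR hVR hL
  obtain ⟨h1, -, h3⟩ := window_pert_small hL hl0 hl1
  have hu := le_neumannRadial_zero hV hV3 (T := R) hr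
  have hd := abs_sub_zeroEnergy_le hV hV3 hR.le hl0 h3 hr
  rw [abs_le] at hd
  nlinarith [hd.1, hr.1]

/-- **The ground state is positive up to the boundary**: `m_λ(r) ≥ r/2` on `[0, L]` for `L ≥ L₀`
(inside by `groundRadial_ge_inside`; on `[R, L]` by the tail formula with `cos ≥ 13/15`,
`sinc ≥ 19/20` on `[0, ½]`). [cite: ErdosSchleinYau2006, Lemma A.1 (ii)] -/
theorem groundRadial_ge {L : ℝ} (hL : neumannThreshold V R ≤ L) {r : ℝ} (hr : r ∈ Icc 0 L) :
    r / 2 ≤ volterraSol (neumannCoeff V (neumannEigenvalue V L)) r := by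
  rcases le_or_gt r R with hrR | hrR
  · have := groundRadial_ge_inside hV hV3 hR hVR hL ⟨hr.1, hrR⟩
    linarith [hr.1]
  · obtain ⟨hl0, hl1, -, -⟩ := neumannEigenvalue_spec hV hV3 hR hVR hL
    obtain ⟨hα, hβ, -, -⟩ := window_data hV hV3 hR hL hl0 hl1
    obtain ⟨-, hx⟩ := window_mul_sq_le hL hl0 hl1
    rw [volterraSol_neumannCoeff_tail hV hV3 hR.le hVR hl0 hrR.le, neumannTail]
    set k := Real.sqrt (neumannEigenvalue V L)
    have hk0 : 0 ≤ k := Real.sqrt_nonneg _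
    have ht0 : 0 ≤ r - R := by linarith
    have hy0 : 0 ≤ k * (r - R) := mul_nonneg hk0 ht0
    have hy : k * (r - R) ≤ 1 / 2 := le_trans (mul_le_mul_of_nonneg_left (by linarith [hr.2]) hk0) hx
    obtain ⟨hc, hs, -, -⟩ := cos_sinc_lower_of_le_half hy0 hy
    have h1 : 3 / 4 * R * (13 / 15) ≤ volterraSol (neumannCoeff V (neumannEigenvalue V L)) R * Real.cos (k * (r - R)) :=
      mul_le_mul hβ hc (by norm_num) (by linarith)
    have h2 : 3 / 4 * ((r - R) * (19 / 20)) ≤ volterraDeriv (neumannCoeff V (neumannEigenvalue V L)) R * ((r - R) * Real.sinc (k * (r - R))) :=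
      mul_le_mul hα (mul_le_mul_of_nonneg_left hs ht0) (by positivity) (by linarith)
    nlinarith [h1, h2, hR]

/-- **The normalisation constant** `c = m_λ(L)/L` satisfies `½ ≤ c ≤ m_λ'(R) + m_λ(R)/L`.
[cite: BoccatoEtAl2019, App. B, (B.3)] -/
theorem groundNorm_bounds {L : ℝ} (hL : neumannThreshold V R ≤ L) :
    1 / 2 ≤ volterraSol (neumannCoeff V (neumannEigenvalue V L)) L / L ∧
    volterraSol (neumannCoeff V (neumannEigenvalue V L)) L / L ≤
      volterraDeriv (neumannCoeff V (neumannEigenvalue V L)) R +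
        volterraSol (neumannCoeff V (neumannEigenvalue V L)) R / L := by
  have hD1 := one_le_sub_of_threshold hL
  have hL0 : 0 < L := by linarith
  constructor
  · rw [le_div_iff₀ hL0]
    have := groundRadial_ge hV hV3 hR hVR hL ⟨hL0.le, le_rfl⟩
    linarith
  · obtain ⟨hl0, hl1, -, -⟩ := neumannEigenvalue_spec hV hV3 hR hVR hL
    obtain ⟨hα, hβ, -, -⟩ := window_data hV hV3 hR hL hl0 hl1
    obtain ⟨-, hx⟩ := window_mul_sq_le hL hl0 hl1
    rw [volterraSol_neumannCoeff_tail hV hV3 hR.le hVR hl0 (by linarith : R ≤ L), neumannTail]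
    set k := Real.sqrt (neumannEigenvalue V L)
    have hy0 : 0 ≤ k * (L - R) := mul_nonneg (Real.sqrt_nonneg _) (by linarith)
    obtain ⟨-, -, hc, hs⟩ := cos_sinc_lower_of_le_half hy0 hx
    rw [div_le_iff₀ hL0, add_mul, div_mul_cancel₀ _ hL0.ne']
    have h1 : volterraSol (neumannCoeff V (neumannEigenvalue V L)) R * Real.cos (k * (L - R)) ≤
        volterraSol (neumannCoeff V (neumannEigenvalue V L)) R := mul_le_of_le_one_right (by nlinarith [hR]) hc
    have h2 : volterraDeriv (neumannCoeff V (neumannEigenvalue V L)) R * ((L - R) * Real.sinc (k * (L - R))) ≤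
        volterraDeriv (neumannCoeff V (neumannEigenvalue V L)) R * L := by
      refine mul_le_mul_of_nonneg_left ?_ (by linarith)
      calc (L - R) * Real.sinc (k * (L - R)) ≤ (L - R) * 1 := mul_le_mul_of_nonneg_left hs (by linarith)
        _ ≤ L := by linarith
    linarith

end GroundRadial

/-! ### The flux `J = r m' - m`, the profile `F = m/r` and the radial maximum principle -/

section MaxPrinciple

variable {V : ℝ → ℝ≥0∞} {R : ℝ}

/-- The **threshold for the profile estimates**: `L₀' = L₀ + (2 + u'(R)) R` (so that also
`(L/R)³` dominates the size `≲ u'(R)` of the normalisation constant). [folklore] -/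
def profileThreshold (V : ℝ → ℝ≥0∞) (R : ℝ) : ℝ :=
  neumannThreshold V R + (2 + volterraDeriv (neumannCoeff V 0) R) * R

/-- `L ≥ L₀'` implies `L ≥ L₀` and `L ≥ (2 + u'(R)) R`. [folklore] -/
theorem profileThreshold_le (hV : Measurable V) (hV3 : ∫⁻ s in Ioi (0 : ℝ), ENNReal.ofReal (s ^ 2) * V s ^ 3 ≠ ⊤)
    (hR : 0 < R) {L : ℝ} (hL : profileThreshold V R ≤ L) :
    neumannThreshold V R ≤ L ∧ (2 + volterraDeriv (neumannCoeff V 0) R) * R ≤ L := by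
  have hα₀ := (zeroEnergy_data_bounds hV hV3 hR).1
  unfold profileThreshold at hL
  have h1 : 0 ≤ (2 + volterraDeriv (neumannCoeff V 0) R) * R := by positivity
  have h2 : R ≤ neumannThreshold V R := by
    unfold neumannThreshold
    have := le_max_left (16 * R) (pertC₁ V R + pertC₂ V R + 1)
    nlinarith
  constructor <;> linarith

/-- **The profile `F = m/r` is differentiable** on `(0, ∞)` with `F'(r) = J(r)/r²`,
`J(r) = r m'(r) - m(r)`, for the regular solution at any energy. [cite: BoccatoEtAl2019, App. B (proof of Lemma 4.1 (iii))] -/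
theorem hasDerivAt_profile (hV : Measurable V) (hV3 : ∫⁻ s in Ioi (0 : ℝ), ENNReal.ofReal (s ^ 2) * V s ^ 3 ≠ ⊤)
    (E : ℝ) {r : ℝ} (hr : 0 < r) :
    HasDerivAt (fun ρ => volterraSol (neumannCoeff V E) ρ / ρ)
      ((r * volterraDeriv (neumannCoeff V E) r - volterraSol (neumannCoeff V E) r) / r ^ 2) r := by
  have hI := integrableOn_id_mul_neumannCoeff hV hV3 E (r + 1)
  have h := hasDerivAt_volterraSol hI (r := r) ⟨hr, by linarith⟩
  have h2 := h.div (hasDerivAt_id r) hr.ne'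
  have h3 : (volterraDeriv (neumannCoeff V E) r * id r - volterraSol (neumannCoeff V E) r * 1) / id r ^ 2 =
      (r * volterraDeriv (neumannCoeff V E) r - volterraSol (neumannCoeff V E) r) / r ^ 2 := by
    simp only [id]; ring
  exact h2.congr_deriv h3

/-- `F = m/r` is continuous on `[a, b]` for `a > 0`. [folklore] -/
theorem continuousOn_profile (hV : Measurable V) (hV3 : ∫⁻ s in Ioi (0 : ℝ), ENNReal.ofReal (s ^ 2) * V s ^ 3 ≠ ⊤)
    (E : ℝ) {a b : ℝ} (ha : 0 < a) :
    ContinuousOn (fun ρ => volterraSol (neumannCoeff V E) ρ / ρ) (Icc a b) := fun _ hr =>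
  (hasDerivAt_profile hV hV3 E (lt_of_lt_of_le ha hr.1)).continuousAt.continuousWithinAt

/-- **The flux identity** `J(r) = r m'(r) - m(r) = ∫₀ʳ s q(s) m(s) ds` (`r ≥ 0`).
[cite: BoccatoEtAl2019, App. B (proof of Lemma 4.1 (iii))] -/
theorem flux_eq (hV : Measurable V) (hV3 : ∫⁻ s in Ioi (0 : ℝ), ENNReal.ofReal (s ^ 2) * V s ^ 3 ≠ ⊤)
    (E : ℝ) {r : ℝ} (hr : 0 ≤ r) :
    r * volterraDeriv (neumannCoeff V E) r - volterraSol (neumannCoeff V E) r =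
      ∫ s in Ioc 0 r, s * (neumannCoeff V E s * volterraSol (neumannCoeff V E) s) :=
  mul_volterraDeriv_sub_volterraSol (integrableOn_id_mul_neumannCoeff hV hV3 E r) ⟨hr, le_rfl⟩

/-- **The flux beyond the range**: for `0 ≤ R ≤ r ≤ r'` (with `V = 0` beyond `R`),
`J(r') - J(r) = -E ∫_r^{r'} s m(s) ds`. [cite: BoccatoEtAl2019, App. B] -/
theorem flux_sub_flux (hV : Measurable V) (hV3 : ∫⁻ s in Ioi (0 : ℝ), ENNReal.ofReal (s ^ 2) * V s ^ 3 ≠ ⊤)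
    (hR : 0 ≤ R) (hVR : ∀ r, R < r → V r = 0) (E : ℝ) {r r' : ℝ} (hr : R ≤ r) (hrr' : r ≤ r') :
    (r' * volterraDeriv (neumannCoeff V E) r' - volterraSol (neumannCoeff V E) r') -
      (r * volterraDeriv (neumannCoeff V E) r - volterraSol (neumannCoeff V E) r) =
      -E * ∫ s in Ioc r r', s * volterraSol (neumannCoeff V E) s := by
  have hr0 : 0 ≤ r := hR.trans hr
  have hI := integrableOn_id_mul_neumannCoeff hV hV3 E r'
  have hqi := integrableOn_id_mul_coeff_mul hI (continuousOn_volterraSol hI) (fun s hs => abs_volterraSol_le_mul hI hs)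
  have hsplit : ∫ s in Ioc 0 r', s * (neumannCoeff V E s * volterraSol (neumannCoeff V E) s) =
      (∫ s in Ioc 0 r, s * (neumannCoeff V E s * volterraSol (neumannCoeff V E) s)) +
        ∫ s in Ioc r r', s * (neumannCoeff V E s * volterraSol (neumannCoeff V E) s) := by
    rw [← setIntegral_union (Ioc_disjoint_Ioc_of_le le_rfl) measurableSet_Ioc
      (hqi.mono_set (Ioc_subset_Ioc_right hrr')) (hqi.mono_set (Ioc_subset_Ioc_left hr0)),
      Ioc_union_Ioc_eq_Ioc hr0 hrr']
  rw [flux_eq hV hV3 E (hr0.trans hrr'), flux_eq hV hV3 E hr0, hsplit, add_sub_cancel_left, ← integral_const_mul]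
  refine setIntegral_congr_fun measurableSet_Ioc fun s hs => ?_
  rw [neumannCoeff_of_range hVR E (lt_of_le_of_lt hr hs.1)]
  ring

/-- **The flux of the ground state beyond the range**: for `L ≥ L₀` and `R ≤ r ≤ L`,
`J(r) = λ ∫_r^L s m_λ(s) ds` (the Neumann condition is `J(L) = 0`).
[cite: BoccatoEtAl2019, App. B (proof of Lemma 4.1 (iii))] -/
theorem flux_ground_outside (hV : Measurable V) (hV3 : ∫⁻ s in Ioi (0 : ℝ), ENNReal.ofReal (s ^ 2) * V s ^ 3 ≠ ⊤)
    (hR : 0 < R) (hVR : ∀ r, R < r → V r = 0) {L : ℝ} (hL : neumannThreshold V R ≤ L) {r : ℝ} (hr : r ∈ Icc R L) :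
    r * volterraDeriv (neumannCoeff V (neumannEigenvalue V L)) r - volterraSol (neumannCoeff V (neumannEigenvalue V L)) r =
      neumannEigenvalue V L * ∫ s in Ioc r L, s * volterraSol (neumannCoeff V (neumannEigenvalue V L)) s := by
  obtain ⟨-, -, hg, -⟩ := neumannEigenvalue_spec hV hV3 hR hVR hL
  have h := flux_sub_flux hV hV3 hR.le hVR (neumannEigenvalue V L) hr.1 hr.2
  have hJL : L * volterraDeriv (neumannCoeff V (neumannEigenvalue V L)) L -
      volterraSol (neumannCoeff V (neumannEigenvalue V L)) L = 0 := hg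
  rw [hJL] at h
  linarith

/-- **Lower bound on the flux beyond the range**: `J(r) ≥ λ (L³ - r³)/6 ≥ 0` on `[R, L]`
(`m_λ(s) ≥ s/2`). [cite: BoccatoEtAl2019, App. B (proof of Lemma 4.1 (iii))] -/
theorem flux_ground_outside_ge (hV : Measurable V) (hV3 : ∫⁻ s in Ioi (0 : ℝ), ENNReal.ofReal (s ^ 2) * V s ^ 3 ≠ ⊤)
    (hR : 0 < R) (hVR : ∀ r, R < r → V r = 0) {L : ℝ} (hL : neumannThreshold V R ≤ L) {r : ℝ} (hr : r ∈ Icc R L) :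
    neumannEigenvalue V L * ((L ^ 3 - r ^ 3) / 6) ≤
      r * volterraDeriv (neumannCoeff V (neumannEigenvalue V L)) r - volterraSol (neumannCoeff V (neumannEigenvalue V L)) r := by
  obtain ⟨hl0, -, -, -⟩ := neumannEigenvalue_spec hV hV3 hR hVR hL
  rw [flux_ground_outside hV hV3 hR hVR hL hr]
  refine mul_le_mul_of_nonneg_left ?_ hl0
  have hr0 : 0 ≤ r := hR.le.trans hr.1
  have hI := integrableOn_id_mul_neumannCoeff hV hV3 (neumannEigenvalue V L) L
  have hmc := continuousOn_volterraSol hI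
  have hi1 : IntegrableOn (fun s => s * volterraSol (neumannCoeff V (neumannEigenvalue V L)) s) (Ioc r L) := by
    have hc : ContinuousOn (fun s => s * volterraSol (neumannCoeff V (neumannEigenvalue V L)) s) (Icc r L) :=
      continuousOn_id.mul (hmc.mono (Icc_subset_Icc_left hr0))
    exact (hc.integrableOn_compact isCompact_Icc).mono_set Ioc_subset_Icc_self
  have hi2 : IntegrableOn (fun s : ℝ => s ^ 2 / 2) (Ioc r L) :=
    (Continuous.integrableOn_Icc (a := r) (b := L) (by fun_prop)).mono_set Ioc_subset_Icc_self
  have h1 : ∫ s in Ioc r L, s ^ 2 / 2 = (L ^ 3 - r ^ 3) / 6 := by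
    rw [← intervalIntegral.integral_of_le hr.2, intervalIntegral.integral_div, integral_pow]; ring
  rw [← h1]
  refine setIntegral_mono_on hi2 hi1 measurableSet_Ioc fun s hs => ?_
  have hm := groundRadial_ge hV hV3 hR hVR hL (r := s) ⟨hr0.trans hs.1.le, hs.2⟩
  have hs0 : 0 ≤ s := hr0.trans hs.1.le
  nlinarith

/-- **The profile increases beyond the range**: `F = m_λ/r` is monotone on `[R, L]`, so
`F(r) ≤ F(L) = c`. [cite: BoccatoEtAl2019, App. B (proof of Lemma 4.1 (ii))] -/
theorem profile_monotoneOn_outside (hV : Measurable V) (hV3 : ∫⁻ s in Ioi (0 : ℝ), ENNReal.ofReal (s ^ 2) * V s ^ 3 ≠ ⊤)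
    (hR : 0 < R) (hVR : ∀ r, R < r → V r = 0) {L : ℝ} (hL : neumannThreshold V R ≤ L) :
    MonotoneOn (fun ρ => volterraSol (neumannCoeff V (neumannEigenvalue V L)) ρ / ρ) (Icc R L) := by
  obtain ⟨hl0, -, -, -⟩ := neumannEigenvalue_spec hV hV3 hR hVR hL
  refine monotoneOn_of_deriv_nonneg (convex_Icc R L) (continuousOn_profile hV hV3 _ hR) ?_ ?_
  · intro r hr
    rw [interior_Icc] at hr
    exact (hasDerivAt_profile hV hV3 _ (hR.trans hr.1)).differentiableAt.differentiableWithinAt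
  · intro r hr
    rw [interior_Icc] at hr
    rw [(hasDerivAt_profile hV hV3 _ (hR.trans hr.1)).deriv]
    refine div_nonneg (le_trans ?_ (flux_ground_outside_ge hV hV3 hR hVR hL ⟨hr.1.le, hr.2.le⟩)) (sq_nonneg _)
    refine mul_nonneg hl0 (div_nonneg ?_ (by norm_num))
    have h1 : r ^ 3 ≤ L ^ 3 := pow_le_pow_left₀ (hR.le.trans hr.1.le) hr.2.le 3
    linarith

/-- **The boundary gap**: `F(L) - F(R) ≥ λ L³/(12R)` for `L ≥ L₀` (`F' = J/r² ≥ λ(L³-r³)/(6r²)`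
and `L ≥ 3R`). [cite: ErdosSchleinYau2006, Lemma A.1 (ii) (`1 - φ(R) ≥ δ`)] -/
theorem profile_gap (hV : Measurable V) (hV3 : ∫⁻ s in Ioi (0 : ℝ), ENNReal.ofReal (s ^ 2) * V s ^ 3 ≠ ⊤)
    (hR : 0 < R) (hVR : ∀ r, R < r → V r = 0) {L : ℝ} (hL : neumannThreshold V R ≤ L) :
    neumannEigenvalue V L * (L ^ 3 / (12 * R)) ≤
      volterraSol (neumannCoeff V (neumannEigenvalue V L)) L / L -
        volterraSol (neumannCoeff V (neumannEigenvalue V L)) R / R := by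
  obtain ⟨hl0, -, -, -⟩ := neumannEigenvalue_spec hV hV3 hR hVR hL
  have hD1 := one_le_sub_of_threshold hL
  obtain ⟨h16, -⟩ := threshold_le_iff_aux hL
  have hRL : R ≤ L := by linarith
  have hL0 : 0 < L := by linarith
  set lam := neumannEigenvalue V L with hlam
  -- `G(s) = F(s) - λ h(s)`, `h(s) = -L³/(6s) - s²/12`, is monotone on `[R, L]`
  set G : ℝ → ℝ := fun s => volterraSol (neumannCoeff V lam) s / s - lam * (-L ^ 3 / 6 * s⁻¹ - s ^ 2 / 12) with hG
  have hdG : ∀ s, 0 < s → HasDerivAt G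
      ((s * volterraDeriv (neumannCoeff V lam) s - volterraSol (neumannCoeff V lam) s) / s ^ 2 -
        lam * (-L ^ 3 / 6 * (-(s ^ 2)⁻¹) - (↑(2 : ℕ) * s ^ (2 - 1)) / 12)) s := fun s hs =>
    (hasDerivAt_profile hV hV3 lam hs).sub
      ((((hasDerivAt_inv hs.ne').const_mul (-L ^ 3 / 6)).sub ((hasDerivAt_pow 2 s).div_const 12)).const_mul lam)
  have hmono : MonotoneOn G (Icc R L) := by
    refine monotoneOn_of_deriv_nonneg (convex_Icc R L) ?_ ?_ ?_
    · exact fun s hs => (hdG s (hR.trans_le hs.1)).continuousAt.continuousWithinAt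
    · intro s hs
      rw [interior_Icc] at hs
      exact (hdG s (hR.trans hs.1)).differentiableAt.differentiableWithinAt
    · intro s hs
      rw [interior_Icc] at hs
      have hs0 : 0 < s := hR.trans hs.1
      rw [(hdG s hs0).deriv]
      have hJ := flux_ground_outside_ge hV hV3 hR hVR hL ⟨hs.1.le, hs.2.le⟩
      rw [← hlam] at hJ
      have e : (s * volterraDeriv (neumannCoeff V lam) s - volterraSol (neumannCoeff V lam) s) / s ^ 2 -
          lam * (-L ^ 3 / 6 * (-(s ^ 2)⁻¹) - (↑(2 : ℕ) * s ^ (2 - 1)) / 12) =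
          ((s * volterraDeriv (neumannCoeff V lam) s - volterraSol (neumannCoeff V lam) s) -
            lam * ((L ^ 3 - s ^ 3) / 6)) / s ^ 2 := by
        field_simp
        ring
      rw [e]
      exact div_nonneg (by linarith) (sq_nonneg _)
  have h1 := hmono ⟨le_rfl, hRL⟩ ⟨hRL, le_rfl⟩ hRL
  simp only [hG] at h1
  -- `h(L) - h(R) ≥ L³/(12R)` for `L ≥ 3R`
  have h2 : lam * (L ^ 3 / (12 * R)) ≤ lam * (-L ^ 3 / 6 * L⁻¹ - L ^ 2 / 12) - lam * (-L ^ 3 / 6 * R⁻¹ - R ^ 2 / 12) := by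
    rw [← mul_sub]
    refine mul_le_mul_of_nonneg_left ?_ hl0
    rw [show -L ^ 3 / 6 * L⁻¹ = -L ^ 2 / 6 by field_simp, show -L ^ 3 / 6 * R⁻¹ = -L ^ 3 / (6 * R) by field_simp,
      div_le_iff₀ (by positivity)]
    have e1 : (-L ^ 2 / 6 - L ^ 2 / 12 - (-L ^ 3 / (6 * R) - R ^ 2 / 12)) * (12 * R) = 2 * L ^ 3 + R ^ 3 - 3 * L ^ 2 * R := by
      field_simp
      ring
    rw [e1]
    nlinarith [sq_nonneg L, pow_nonneg hR.le 3, mul_nonneg (sq_nonneg L) (by linarith : 0 ≤ L - 3 * R)]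
  linarith

/-- **Inside flux lower bound**: if `m_λ(t) ≤ M t` on `(0, s]` (`s ≤ R`, `M ≥ 0`), then
`J(s) ≥ -λ M s³/3` (`J(s) = ∫₀ˢ t(½V - λ)m ≥ -λ∫₀ˢ t m`). [cite: ErdosSchleinYau2006, Lemma A.1 (ii) (maximum principle)] -/
theorem flux_ground_inside_ge (hV : Measurable V) (hV3 : ∫⁻ s in Ioi (0 : ℝ), ENNReal.ofReal (s ^ 2) * V s ^ 3 ≠ ⊤)
    (hR : 0 < R) (hVR : ∀ r, R < r → V r = 0) {L : ℝ} (hL : neumannThreshold V R ≤ L) {s M : ℝ} (hs : s ∈ Ioc 0 L)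
    (hM : ∀ t ∈ Ioc 0 s, volterraSol (neumannCoeff V (neumannEigenvalue V L)) t ≤ M * t) :
    -(neumannEigenvalue V L * M * s ^ 3 / 3) ≤
      s * volterraDeriv (neumannCoeff V (neumannEigenvalue V L)) s - volterraSol (neumannCoeff V (neumannEigenvalue V L)) s := by
  obtain ⟨hl0, -, -, -⟩ := neumannEigenvalue_spec hV hV3 hR hVR hL
  set lam := neumannEigenvalue V L with hlam
  have hI := integrableOn_id_mul_neumannCoeff hV hV3 lam s
  have hmc := continuousOn_volterraSol hI
  have hmb : ∀ t ∈ Icc 0 s, |volterraSol (neumannCoeff V lam) t| ≤ Real.exp (volterraWeight (neumannCoeff V lam) s) * t :=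
    fun t ht => abs_volterraSol_le_mul hI ht
  rw [flux_eq hV hV3 lam hs.1.le]
  -- split `t q m = t ½V m - λ t m` and drop the non-negative first part
  have hI0 := integrableOn_id_mul_neumannCoeff hV hV3 0 s
  have hiV : IntegrableOn (fun t => t * (neumannCoeff V 0 t * volterraSol (neumannCoeff V lam) t)) (Ioc 0 s) :=
    integrableOn_id_mul_coeff_mul hI0 hmc hmb
  have him : IntegrableOn (fun t => t * volterraSol (neumannCoeff V lam) t) (Ioc 0 s) :=
    ((continuousOn_id.mul hmc).integrableOn_compact isCompact_Icc).mono_set Ioc_subset_Icc_self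
  have hsplit : ∫ t in Ioc 0 s, t * (neumannCoeff V lam t * volterraSol (neumannCoeff V lam) t) =
      (∫ t in Ioc 0 s, t * (neumannCoeff V 0 t * volterraSol (neumannCoeff V lam) t)) -
        lam * ∫ t in Ioc 0 s, t * volterraSol (neumannCoeff V lam) t := by
    rw [← integral_const_mul, ← integral_sub hiV (him.const_mul lam)]
    refine setIntegral_congr_fun measurableSet_Ioc fun t _ => ?_
    simp only [neumannCoeff, sub_zero]
    ring
  rw [hsplit]
  have hm0 : ∀ t ∈ Ioc 0 s, 0 ≤ volterraSol (neumannCoeff V lam) t := fun t ht => by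
    have := groundRadial_ge hV hV3 hR hVR hL (r := t) ⟨ht.1.le, ht.2.trans hs.2⟩
    rw [← hlam] at this; linarith [ht.1]
  have h1 : 0 ≤ ∫ t in Ioc 0 s, t * (neumannCoeff V 0 t * volterraSol (neumannCoeff V lam) t) :=
    setIntegral_nonneg measurableSet_Ioc fun t ht =>
      mul_nonneg ht.1.le (mul_nonneg (neumannCoeff_zero_nonneg V t) (hm0 t ht))
  have h2 : ∫ t in Ioc 0 s, t * volterraSol (neumannCoeff V lam) t ≤ M * s ^ 3 / 3 := by
    have hi3 : IntegrableOn (fun t : ℝ => M * t ^ 2) (Ioc 0 s) :=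
      (Continuous.integrableOn_Icc (a := 0) (b := s) (by fun_prop)).mono_set Ioc_subset_Icc_self
    have h3 : ∫ t in Ioc 0 s, M * t ^ 2 = M * s ^ 3 / 3 := by
      rw [integral_const_mul, ← intervalIntegral.integral_of_le hs.1.le, integral_pow]; ring
    rw [← h3]
    refine setIntegral_mono_on him hi3 measurableSet_Ioc fun t ht => ?_
    have := hM t ht
    nlinarith [ht.1]
  nlinarith [mul_le_mul_of_nonneg_left h2 hl0]

/-- **Inside comparison**: if `m_λ(t) ≤ M t` on `(0, R]`, `M ≥ 0`, then for `ρ ∈ (0, R]`,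
`F(ρ) ≤ F(R) + λ M (R² - ρ²)/6` (`G = F + λMs²/6` is monotone on `[ρ, R]`).
[cite: ErdosSchleinYau2006, Lemma A.1 (ii) (maximum principle with `φ + CL⁻³x²`)] -/
theorem profile_inside_le (hV : Measurable V) (hV3 : ∫⁻ s in Ioi (0 : ℝ), ENNReal.ofReal (s ^ 2) * V s ^ 3 ≠ ⊤)
    (hR : 0 < R) (hVR : ∀ r, R < r → V r = 0) {L : ℝ} (hL : neumannThreshold V R ≤ L) {M : ℝ}
    (hM : ∀ t ∈ Ioc 0 R, volterraSol (neumannCoeff V (neumannEigenvalue V L)) t ≤ M * t) {ρ : ℝ} (hρ : ρ ∈ Ioc 0 R) :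
    volterraSol (neumannCoeff V (neumannEigenvalue V L)) ρ / ρ ≤
      volterraSol (neumannCoeff V (neumannEigenvalue V L)) R / R + neumannEigenvalue V L * M * (R ^ 2 - ρ ^ 2) / 6 := by
  obtain ⟨hl0, -, -, -⟩ := neumannEigenvalue_spec hV hV3 hR hVR hL
  have hD1 := one_le_sub_of_threshold hL
  have hRL : R ≤ L := by linarith
  set lam := neumannEigenvalue V L with hlam
  set F : ℝ → ℝ := fun s => volterraSol (neumannCoeff V lam) s / s with hF
  set G : ℝ → ℝ := fun s => F s + lam * M * s ^ 2 / 6 with hG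
  have hdG : ∀ s, 0 < s → HasDerivAt G
      ((s * volterraDeriv (neumannCoeff V lam) s - volterraSol (neumannCoeff V lam) s) / s ^ 2 +
        lam * M * (↑(2 : ℕ) * s ^ (2 - 1)) / 6) s := fun s hs =>
    (hasDerivAt_profile hV hV3 lam hs).add (((hasDerivAt_pow 2 s).const_mul (lam * M)).div_const 6)
  have hmono : MonotoneOn G (Icc ρ R) := by
    refine monotoneOn_of_deriv_nonneg (convex_Icc ρ R) ?_ ?_ ?_
    · exact fun s hs => (hdG s (hρ.1.trans_le hs.1)).continuousAt.continuousWithinAt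
    · intro s hs
      rw [interior_Icc] at hs
      exact (hdG s (hρ.1.trans hs.1)).differentiableAt.differentiableWithinAt
    · intro s hs
      rw [interior_Icc] at hs
      have hs0 : 0 < s := hρ.1.trans hs.1
      rw [(hdG s hs0).deriv]
      have hJ := flux_ground_inside_ge hV hV3 hR hVR hL (s := s) (M := M) ⟨hs0, hs.2.le.trans hRL⟩
        (fun t ht => hM t ⟨ht.1, ht.2.trans hs.2.le⟩)
      rw [← hlam] at hJ
      have h1 : (s * volterraDeriv (neumannCoeff V lam) s - volterraSol (neumannCoeff V lam) s) / s ^ 2 +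
          lam * M * (↑(2 : ℕ) * s ^ (2 - 1)) / 6 =
          ((s * volterraDeriv (neumannCoeff V lam) s - volterraSol (neumannCoeff V lam) s) + lam * M * s ^ 3 / 3) / s ^ 2 := by
        field_simp
        ring
      rw [h1]
      exact div_nonneg (by linarith) (sq_nonneg _)
  have h := hmono ⟨le_rfl, hρ.2⟩ ⟨hρ.2, le_rfl⟩ hρ.2
  simp only [hG, hF] at h
  nlinarith [h]

/-- **Size of the normalisation constant**: `c = m_λ(L)/L ≤ (18/17)(u'(R) + ¼)` for `L ≥ L₀`.
[folklore] -/
theorem groundNorm_le (hV : Measurable V) (hV3 : ∫⁻ s in Ioi (0 : ℝ), ENNReal.ofReal (s ^ 2) * V s ^ 3 ≠ ⊤)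
    (hR : 0 < R) (hVR : ∀ r, R < r → V r = 0) {L : ℝ} (hL : neumannThreshold V R ≤ L) :
    volterraSol (neumannCoeff V (neumannEigenvalue V L)) L / L ≤
      18 / 17 * (volterraDeriv (neumannCoeff V 0) R + 1 / 4) := by
  obtain ⟨hl0, hl1, -, -⟩ := neumannEigenvalue_spec hV hV3 hR hVR hL
  obtain ⟨-, -, hαd, hβd⟩ := window_data hV hV3 hR hL hl0 hl1
  obtain ⟨hC1, hC2, -⟩ := window_pert_small hL hl0 hl1
  obtain ⟨hα₀, -, hβ₀'⟩ := zeroEnergy_data_bounds hV hV3 hR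
  obtain ⟨h16, -⟩ := threshold_le_iff_aux hL
  have hD1 := one_le_sub_of_threshold hL
  have hL0 : 0 < L := by linarith
  have hc := (groundNorm_bounds hV hV3 hR hVR hL).2
  rw [abs_le] at hαd hβd
  have hα : volterraDeriv (neumannCoeff V (neumannEigenvalue V L)) R ≤ volterraDeriv (neumannCoeff V 0) R + 1 / 4 := by
    linarith [hαd.2]
  have hβ : volterraSol (neumannCoeff V (neumannEigenvalue V L)) R ≤ R * (volterraDeriv (neumannCoeff V 0) R + 1 / 4) := by
    nlinarith [hβd.2, hR]
  have h17 : 17 * R ≤ L := by linarith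
  have hβL : volterraSol (neumannCoeff V (neumannEigenvalue V L)) R / L ≤ (volterraDeriv (neumannCoeff V 0) R + 1 / 4) / 17 := by
    rw [div_le_div_iff₀ hL0 (by norm_num)]
    nlinarith [hβ]
  linarith

/-- **Lemma 2.1 (ii), first half: `f_ℓ ≤ 1`** — in unnormalised form `m_λ(r) ≤ c r`, `c = m_λ(L)/L`,
on `(0, L]`, for `L ≥ L₀'` (radial maximum principle: with `M = sup_{(0,R]} m_λ/r`,
`M ≤ F(R) + λMR²/6 ≤ c - λL³/(12R) + λMR²/6 ≤ c`; beyond the range `m_λ/r` increases).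
[cite: BastiCenatiempoSchlein2021, Lemma 2.1 (ii); BoccatoEtAl2019, Lemma 4.1 (ii); ErdosSchleinYau2006, Lemma A.1 (ii)] -/
theorem groundRadial_le_norm_mul (hV : Measurable V) (hV3 : ∫⁻ s in Ioi (0 : ℝ), ENNReal.ofReal (s ^ 2) * V s ^ 3 ≠ ⊤)
    (hR : 0 < R) (hVR : ∀ r, R < r → V r = 0) {L : ℝ} (hL : profileThreshold V R ≤ L) {r : ℝ} (hr : r ∈ Ioc 0 L) :
    volterraSol (neumannCoeff V (neumannEigenvalue V L)) r ≤
      volterraSol (neumannCoeff V (neumannEigenvalue V L)) L / L * r := by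
  obtain ⟨hL', hLα⟩ := profileThreshold_le hV hV3 hR hL
  obtain ⟨hl0, hl1, -, -⟩ := neumannEigenvalue_spec hV hV3 hR hVR hL'
  obtain ⟨hlD, -⟩ := window_mul_sq_le hL' hl0 hl1
  obtain ⟨h16, -⟩ := threshold_le_iff_aux hL'
  obtain ⟨hα₀, -, -⟩ := zeroEnergy_data_bounds hV hV3 hR
  have hD1 := one_le_sub_of_threshold hL'
  have hRL : R ≤ L := by linarith
  have hL0 : 0 < L := by linarith
  set lam := neumannEigenvalue V L with hlam
  set c := volterraSol (neumannCoeff V lam) L / L with hcdef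
  have hc0 : 1 / 2 ≤ c := (groundNorm_bounds hV hV3 hR hVR hL').1
  have hcle : c ≤ 18 / 17 * (volterraDeriv (neumannCoeff V 0) R + 1 / 4) := groundNorm_le hV hV3 hR hVR hL'
  -- the supremum `M` of `F = m/r` over `(0, R]`
  have hI := integrableOn_id_mul_neumannCoeff hV hV3 lam R
  set B := Real.exp (volterraWeight (neumannCoeff V lam) R) with hB
  set S := (fun ρ => volterraSol (neumannCoeff V lam) ρ / ρ) '' Ioc 0 R with hS
  have hbdd : BddAbove S := by
    refine ⟨B, ?_⟩
    rintro y ⟨ρ, hρ, rfl⟩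
    have h1 := abs_volterraSol_le_mul hI (Ioc_subset_Icc_self hρ)
    rw [div_le_iff₀ hρ.1]
    exact (le_abs_self _).trans h1
  have hne : S.Nonempty := ⟨_, ⟨R, ⟨hR, le_rfl⟩, rfl⟩⟩
  set M := sSup S with hMdef
  have hFle : ∀ t ∈ Ioc 0 R, volterraSol (neumannCoeff V lam) t / t ≤ M := fun t ht => le_csSup hbdd ⟨t, ht, rfl⟩
  have hM : ∀ t ∈ Ioc 0 R, volterraSol (neumannCoeff V lam) t ≤ M * t := fun t ht => by
    have := hFle t ht; rwa [div_le_iff₀ ht.1] at this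
  have hFR : 3 / 4 ≤ volterraSol (neumannCoeff V lam) R / R := by
    rw [le_div_iff₀ hR]
    have := groundRadial_ge_inside hV hV3 hR hVR hL' (r := R) ⟨hR.le, le_rfl⟩
    rw [← hlam] at this; linarith
  have hM0 : 0 ≤ M := by linarith [hFle R ⟨hR, le_rfl⟩]
  -- the key inequality `M ≤ F(R) + λ M R²/6`
  have hkey : M ≤ volterraSol (neumannCoeff V lam) R / R + lam * M * R ^ 2 / 6 := by
    refine csSup_le hne ?_
    rintro y ⟨ρ, hρ, rfl⟩
    have h := profile_inside_le hV hV3 hR hVR hL' (M := M) hM hρ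
    rw [← hlam] at h
    have : 0 ≤ lam * M * ρ ^ 2 := by positivity
    linarith
  -- the gap and the size of `c`
  have hgap := profile_gap hV hV3 hR hVR hL'
  rw [← hlam] at hgap
  have hlamR : lam * R ^ 2 ≤ 1 / 4 := by
    have : R ^ 2 ≤ (L - R) ^ 2 := pow_le_pow_left₀ hR.le (by linarith) 2
    nlinarith
  have hM2 : M ≤ 24 / 23 * c := by
    -- from `M ≤ c + λ M R²/6` and `λR² ≤ ¼`
    have h1 : M ≤ c + lam * M * R ^ 2 / 6 := by
      have : volterraSol (neumannCoeff V lam) R / R ≤ c := by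
        have := hgap; nlinarith [mul_nonneg hl0 (by positivity : (0:ℝ) ≤ L ^ 3 / (12 * R))]
      linarith
    nlinarith [mul_le_mul_of_nonneg_left hlamR hM0]
  have hM3 : 2 * M * R ^ 3 ≤ L ^ 3 := by
    have h1 : ((2 + volterraDeriv (neumannCoeff V 0) R) * R) ^ 3 ≤ L ^ 3 := pow_le_pow_left₀ (by positivity) hLα 3
    have h2 : (8 + 12 * volterraDeriv (neumannCoeff V 0) R) * R ^ 3 ≤ ((2 + volterraDeriv (neumannCoeff V 0) R) * R) ^ 3 := by
      have : 8 + 12 * volterraDeriv (neumannCoeff V 0) R ≤ (2 + volterraDeriv (neumannCoeff V 0) R) ^ 3 := by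
        nlinarith [sq_nonneg (volterraDeriv (neumannCoeff V 0) R), hα₀]
      calc _ ≤ (2 + volterraDeriv (neumannCoeff V 0) R) ^ 3 * R ^ 3 := by gcongr
        _ = _ := by ring
    have h3 : 2 * M ≤ 8 + 12 * volterraDeriv (neumannCoeff V 0) R := by linarith
    nlinarith [pow_nonneg hR.le 3]
  have hMc : M ≤ c := by
    -- `M - c ≤ λ (M R²/6 - L³/(12R)) ≤ 0`
    have h1 : M ≤ c - lam * (L ^ 3 / (12 * R)) + lam * M * R ^ 2 / 6 := by linarith
    have h2 : lam * M * R ^ 2 / 6 ≤ lam * (L ^ 3 / (12 * R)) := by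
      have h3 : M * R ^ 2 / 6 ≤ L ^ 3 / (12 * R) := by
        rw [div_le_div_iff₀ (by norm_num) (by positivity)]
        nlinarith [hM3]
      nlinarith [mul_le_mul_of_nonneg_left h3 hl0]
    linarith
  -- conclusion
  rcases le_or_gt r R with hrR | hrR
  · exact (hM r ⟨hr.1, hrR⟩).trans (mul_le_mul_of_nonneg_right hMc hr.1.le)
  · have hmono := profile_monotoneOn_outside hV hV3 hR hVR hL' ⟨hrR.le, hr.2⟩ ⟨hRL, le_rfl⟩ hr.2
    simp only [← hlam] at hmono
    rw [div_le_iff₀ hr.1] at hmono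
    exact hmono

end MaxPrinciple

/-! ### Lemma 2.1 (ii): `∫ V f_ℓ = 8π𝔞 + O(L⁻¹)` in radial form -/

section PotentialIntegral

variable {V : ℝ → ℝ≥0∞} {R : ℝ}

/-- **`0 ≤ b_λ ≤ R`** (`b_λ = m_λ(R)/m_λ'(R)`): `0 ≤ m_λ(R) ≤ R m_λ'(R)` for `L ≥ L₀` (the a priori
step of the root analysis: `λ D²L/4 ≤ a_λ = R - b_λ`). [cite: ErdosSchleinYau2006, Lemma A.1 (i)] -/
theorem ground_data_le (hV : Measurable V) (hV3 : ∫⁻ s in Ioi (0 : ℝ), ENNReal.ofReal (s ^ 2) * V s ^ 3 ≠ ⊤)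
    (hR : 0 < R) (hVR : ∀ r, R < r → V r = 0) {L : ℝ} (hL : neumannThreshold V R ≤ L) :
    0 ≤ volterraSol (neumannCoeff V (neumannEigenvalue V L)) R ∧
      volterraSol (neumannCoeff V (neumannEigenvalue V L)) R ≤ R * volterraDeriv (neumannCoeff V (neumannEigenvalue V L)) R := by
  obtain ⟨hl0, hl1, hg, -⟩ := neumannEigenvalue_spec hV hV3 hR hVR hL
  have hD1 : 1 ≤ L - R := one_le_sub_of_threshold hL
  obtain ⟨hα, hβ, -, -⟩ := window_data hV hV3 hR hL hl0 hl1
  obtain ⟨hED4, -⟩ := window_mul_sq_le hL hl0 hl1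
  have hroot0 := hg
  rw [neumannBdry_eq hV hV3 hR.le hVR hl0 (by linarith only [hD1] : R ≤ L)] at hroot0
  set lam := neumannEigenvalue V L with hlam
  set α := volterraDeriv (neumannCoeff V lam) R with hαdef
  set β := volterraSol (neumannCoeff V lam) R with hβdef
  set D := L - R with hDdef
  clear_value lam α β D
  have hD : 0 < D := by linarith only [hD1]
  have hLD : L = D + R := by rw [hDdef]; ring
  have hL0 : 0 < L := by linarith only [hD1, hLD, hR]
  have hDL : D ≤ L := by linarith only [hLD, hR]
  have hαpos : 0 < α := by linarith only [hα]
  have hβpos : 0 ≤ β := by nlinarith only [hβ, hR]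
  refine ⟨hβpos, ?_⟩
  set b := β / α with hbdef
  clear_value b
  have hb0 : 0 ≤ b := by rw [hbdef]; exact div_nonneg hβpos hαpos.le
  have hED : lam * D ^ 2 ≤ 1 := by linarith only [hED4]
  have hroot : (L * Real.cos (Real.sqrt lam * D) - D * Real.sinc (Real.sqrt lam * D)) -
      b * (Real.cos (Real.sqrt lam * D) + lam * L * D * Real.sinc (Real.sqrt lam * D)) = 0 := by
    have h := congrArg (fun t => t / α) hroot0
    simp only [zero_div] at h
    rw [← h, hbdef]
    field_simp
  have hA := root_estimate hl0 hD.le hDL hED hroot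
  rw [abs_of_nonneg hb0] at hA
  set P := D ^ 2 * (3 * L - D) / 6 + b * D * (L - D / 2) with hPdef
  clear_value P
  have hbDL : 0 ≤ b * D * L := by positivity
  have hPge : D ^ 2 * L / 3 + b * D * L / 2 ≤ P := by
    have h1 : P - (D ^ 2 * L / 3 + b * D * L / 2) = D ^ 2 * (L - D) / 6 + b * D * (L - D) / 2 := by rw [hPdef]; ring
    have h2 : 0 ≤ D ^ 2 * (L - D) / 6 + b * D * (L - D) / 2 := by
      have : 0 ≤ L - D := by linarith only [hDL]
      positivity
    linarith only [h1, h2]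
  have hrem : lam ^ 2 * L * D ^ 3 * (D / 16 + b / 4) ≤ lam * (L * D ^ 2 / 64 + L * D * b / 16) := by
    have h1 : lam ^ 2 * L * D ^ 3 * (D / 16 + b / 4) = lam * (lam * D ^ 2) * (L * D * (D / 16 + b / 4)) := by ring
    rw [h1]
    have h2 : 0 ≤ L * D * (D / 16 + b / 4) := by positivity
    calc lam * (lam * D ^ 2) * (L * D * (D / 16 + b / 4)) ≤ lam * (1 / 4) * (L * D * (D / 16 + b / 4)) :=
          mul_le_mul_of_nonneg_right (mul_le_mul_of_nonneg_left (by linarith only [hED4]) hl0) h2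
      _ = lam * (L * D ^ 2 / 64 + L * D * b / 16) := by ring
  have hlamDL : 0 ≤ lam * (D ^ 2 * L) := by positivity
  have hlambDL : 0 ≤ lam * (b * D * L) := by positivity
  have haEge : lam * (D ^ 2 * L) / 4 ≤ L - D - b := by
    have h1 := (abs_le.1 hA).2
    have h3 : lam * (D ^ 2 * L / 3 + b * D * L / 2) ≤ lam * P := mul_le_mul_of_nonneg_left hPge hl0
    linarith only [h1, h3, hrem, hlamDL, hlambDL]
  have hbR : b ≤ R := by
    have : 0 ≤ L - D - b := le_trans (by positivity) haEge
    linarith only [this, hLD]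
  rw [hbdef, div_le_iff₀ hαpos] at hbR
  linarith only [hbR]

/-- **The total flux vanishes**: `∫₀ᴸ s V(s) m_λ(s) ds = 2λ ∫₀ᴸ s m_λ(s) ds` (the Neumann condition
`J(L) = 0` with `J(L) = ∫₀ᴸ s(½V - λ)m`). [cite: BoccatoEtAl2019, App. B (proof of Lemma 4.1 (ii): "the first contribution vanishes")] -/
theorem integral_pot_ground_eq (hV : Measurable V) (hV3 : ∫⁻ s in Ioi (0 : ℝ), ENNReal.ofReal (s ^ 2) * V s ^ 3 ≠ ⊤)
    (hR : 0 < R) (hVR : ∀ r, R < r → V r = 0) {L : ℝ} (hL : neumannThreshold V R ≤ L) :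
    ∫ s in Ioc 0 L, s * ((V s).toReal * volterraSol (neumannCoeff V (neumannEigenvalue V L)) s) =
      2 * neumannEigenvalue V L * ∫ s in Ioc 0 L, s * volterraSol (neumannCoeff V (neumannEigenvalue V L)) s := by
  obtain ⟨hl0, -, hg, -⟩ := neumannEigenvalue_spec hV hV3 hR hVR hL
  have hD1 : 1 ≤ L - R := one_le_sub_of_threshold hL
  have hL0 : 0 ≤ L := by linarith
  set lam := neumannEigenvalue V L with hlam
  have hJ := flux_eq hV hV3 lam hL0
  have hJ0 : L * volterraDeriv (neumannCoeff V lam) L - volterraSol (neumannCoeff V lam) L = 0 := hg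
  rw [hJ0] at hJ
  have hI := integrableOn_id_mul_neumannCoeff hV hV3 lam L
  have hmc := continuousOn_volterraSol hI
  have hmb : ∀ t ∈ Icc 0 L, |volterraSol (neumannCoeff V lam) t| ≤ Real.exp (volterraWeight (neumannCoeff V lam) L) * t :=
    fun t ht => abs_volterraSol_le_mul hI ht
  have hI0 := integrableOn_id_mul_neumannCoeff hV hV3 0 L
  have hiV : IntegrableOn (fun t => t * (neumannCoeff V 0 t * volterraSol (neumannCoeff V lam) t)) (Ioc 0 L) :=
    integrableOn_id_mul_coeff_mul hI0 hmc hmb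
  have him : IntegrableOn (fun t => t * volterraSol (neumannCoeff V lam) t) (Ioc 0 L) :=
    ((continuousOn_id.mul hmc).integrableOn_compact isCompact_Icc).mono_set Ioc_subset_Icc_self
  have hsplit : ∫ t in Ioc 0 L, t * (neumannCoeff V lam t * volterraSol (neumannCoeff V lam) t) =
      (∫ t in Ioc 0 L, t * (neumannCoeff V 0 t * volterraSol (neumannCoeff V lam) t)) -
        lam * ∫ t in Ioc 0 L, t * volterraSol (neumannCoeff V lam) t := by
    rw [← integral_const_mul, ← integral_sub hiV (him.const_mul lam)]
    refine setIntegral_congr_fun measurableSet_Ioc fun t _ => ?_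
    simp only [neumannCoeff, sub_zero]
    ring
  rw [hsplit] at hJ
  have h2 : ∫ t in Ioc 0 L, t * ((V t).toReal * volterraSol (neumannCoeff V lam) t) =
      2 * ∫ t in Ioc 0 L, t * (neumannCoeff V 0 t * volterraSol (neumannCoeff V lam) t) := by
    rw [← integral_const_mul]
    refine setIntegral_congr_fun measurableSet_Ioc fun t _ => ?_
    simp only [neumannCoeff, sub_zero]
    ring
  rw [h2]
  linarith

/-- The outside main term: `∫_R^L s(β + α(s - R)) ds = β(L² - R²)/2 + α((L³ - R³)/3 - R(L² - R²)/2)`.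
[folklore] -/
theorem integral_outside_main (α β : ℝ) {R L : ℝ} (hRL : R ≤ L) :
    ∫ s in Ioc R L, s * (β + α * (s - R)) = β * ((L ^ 2 - R ^ 2) / 2) + α * ((L ^ 3 - R ^ 3) / 3 - R * ((L ^ 2 - R ^ 2) / 2)) := by
  rw [← intervalIntegral.integral_of_le hRL]
  have h1 : ∀ s : ℝ, s * (β + α * (s - R)) = β * s + α * s ^ 2 - (α * R) * s := fun s => by ring
  simp_rw [h1]
  rw [intervalIntegral.integral_sub, intervalIntegral.integral_add, intervalIntegral.integral_const_mul,
    intervalIntegral.integral_const_mul, intervalIntegral.integral_const_mul, integral_id, integral_pow]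
  · ring
  all_goals first
    | exact ((continuous_const.mul continuous_id).intervalIntegrable _ _)
    | exact (Continuous.intervalIntegrable (by fun_prop) _ _)

/-- `∫_R^L (s - R) ds = (L - R)²/2`. [folklore] -/
theorem integral_sub_const_eq {R L : ℝ} (hRL : R ≤ L) : ∫ s in Ioc R L, (s - R) = (L - R) ^ 2 / 2 := by
  rw [← intervalIntegral.integral_of_le hRL, intervalIntegral.integral_sub (f := fun x : ℝ => x) (g := fun _ : ℝ => R)
    (continuous_id.intervalIntegrable _ _) (continuous_const.intervalIntegrable _ _), integral_id,
    intervalIntegral.integral_const]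
  simp only [smul_eq_mul]
  ring

/-- **`|a_λ - a| L ≤ (16/3) R²`** with `a_λ = R - m_λ(R)/m_λ'(R)` and `a` the scattering length,
for `L ≥ L₀`. [cite: ErdosSchleinYau2006, Lemma A.1 (i)] -/
theorem abs_aE_sub_a_mul_le (hV : Measurable V) (hV3 : ∫⁻ s in Ioi (0 : ℝ), ENNReal.ofReal (s ^ 2) * V s ^ 3 ≠ ⊤)
    (hR : 0 < R) (hVR : ∀ r, R < r → V r = 0) {L : ℝ} (hL : neumannThreshold V R ≤ L) :
    |(R - volterraSol (neumannCoeff V (neumannEigenvalue V L)) R / volterraDeriv (neumannCoeff V (neumannEigenvalue V L)) R) -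
        volterraScatteringLength V R| * L ≤ 16 / 3 * R ^ 2 := by
  obtain ⟨hl0, hl1, -, -⟩ := neumannEigenvalue_spec hV hV3 hR hVR hL
  obtain ⟨-, hlamB⟩ := abs_neumannEigenvalue_sub_le hV hV3 hR hVR hL
  have hD1 : 1 ≤ L - R := one_le_sub_of_threshold hL
  obtain ⟨-, hC12⟩ := threshold_le_iff_aux hL
  have hC₁ := pertC₁_nonneg (V := V) (R := R)
  have hC₂ := pertC₂_nonneg (V := V) (R := R)
  obtain ⟨hα, -, hαd, hβd⟩ := window_data hV hV3 hR hL hl0 hl1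
  obtain ⟨hα₀, hβ₀, hβ₀'⟩ := zeroEnergy_data_bounds hV hV3 hR
  have ha' : volterraScatteringLength V R =
      R - volterraSol (neumannCoeff V 0) R / volterraDeriv (neumannCoeff V 0) R := rfl
  rw [ha']
  set lam := neumannEigenvalue V L with hlam
  set α := volterraDeriv (neumannCoeff V lam) R with hαdef
  set β := volterraSol (neumannCoeff V lam) R with hβdef
  set α₀ := volterraDeriv (neumannCoeff V 0) R with hα₀def
  set β₀ := volterraSol (neumannCoeff V 0) R with hβ₀def
  set C₁ := pertC₁ V R with hC₁def
  set C₂ := pertC₂ V R with hC₂def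
  set D := L - R with hDdef
  clear_value lam α β α₀ β₀ C₁ C₂ D
  have hL0 : 0 < L := by linarith only [hD1, hR, hDdef]
  have hαpos : 0 < α := by linarith only [hα]
  have hα₀pos : 0 < α₀ := by linarith only [hα₀]
  have h1 : (R - β / α) - (R - β₀ / α₀) = (β₀ * α - β * α₀) / (α * α₀) := by field_simp; ring
  have h2 : |β₀ * α - β * α₀| ≤ α₀ * R * lam * (C₁ + C₂) := by
    have h3 : β₀ * α - β * α₀ = β₀ * (α - α₀) - α₀ * (β - β₀) := by ring
    rw [h3]
    calc |β₀ * (α - α₀) - α₀ * (β - β₀)| ≤ |β₀ * (α - α₀)| + |α₀ * (β - β₀)| := abs_sub _ _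
      _ = β₀ * |α - α₀| + α₀ * |β - β₀| := by
          rw [abs_mul, abs_mul, abs_of_nonneg (by linarith only [hβ₀, hR] : 0 ≤ β₀), abs_of_nonneg hα₀pos.le]
      _ ≤ (R * α₀) * (C₂ * lam) + α₀ * (C₁ * lam * R) := by gcongr
      _ = α₀ * R * lam * (C₁ + C₂) := by ring
  have h4 : |(R - β / α) - (R - β₀ / α₀)| ≤ 4 / 3 * R * lam * (C₁ + C₂) := by
    rw [h1, abs_div, abs_of_pos (mul_pos hαpos hα₀pos), div_le_iff₀ (mul_pos hαpos hα₀pos)]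
    refine h2.trans ?_
    have h5 : 0 ≤ α₀ * R * lam * (C₁ + C₂) := by positivity
    have h6 : α₀ * R * lam * (C₁ + C₂) * 1 ≤ α₀ * R * lam * (C₁ + C₂) * (4 / 3 * α) :=
      mul_le_mul_of_nonneg_left (by linarith only [hα]) h5
    linarith only [h6]
  have h6 : lam * (C₁ + C₂) * L ≤ 4 * R := by
    have h7 : C₁ + C₂ ≤ D := by linarith only [hC12]
    calc lam * (C₁ + C₂) * L ≤ lam * D * L := by gcongr
      _ ≤ lam * D * L * D := le_mul_of_one_le_right (by positivity) hD1
      _ = lam * (D ^ 2 * L) := by ring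
      _ ≤ 4 * R := hlamB
  calc |(R - β / α) - (R - β₀ / α₀)| * L ≤ 4 / 3 * R * lam * (C₁ + C₂) * L := mul_le_mul_of_nonneg_right h4 hL0.le
    _ = 4 / 3 * R * (lam * (C₁ + C₂) * L) := by ring
    _ ≤ 4 / 3 * R * (4 * R) := by gcongr
    _ = 16 / 3 * R ^ 2 := by ring

/-- **Lemma 2.1 (ii), second half, in radial form: `∫ V f_ℓ = 8π𝔞 + O(L⁻¹)`.** With
`I = ∫₀ᴸ s m_λ(s) ds` and `c = m_λ(L)/L` (so that `∫_{ℝ³} V f_ℓ = (4π/c)∫₀ᴸ sVm_λ = 8π λI/c` by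
`integral_pot_ground_eq`): `|λI/c - a| ≤ 9R²/L` for `L ≥ L₀'` (the exact flux identity
`λ∫_R^L s m_λ = J(R) = m_λ'(R) a_λ`, `0 ≤ ∫₀ᴿ s m_λ ≤ cR³/3`, `|m_λ(L) - m_λ'(R)(L - a_λ)| ≤ 0.93 m_λ'(R) R`,
`|a_λ - a| ≤ (16/3)R²/L`). [cite: BastiCenatiempoSchlein2021, Lemma 2.1 (ii); BoccatoEtAl2019, Lemma 4.1 (ii) (4.6), App. B] -/
theorem abs_flux_ratio_sub_scatteringLength_le (hV : Measurable V) (hV3 : ∫⁻ s in Ioi (0 : ℝ), ENNReal.ofReal (s ^ 2) * V s ^ 3 ≠ ⊤)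
    (hR : 0 < R) (hVR : ∀ r, R < r → V r = 0) {L : ℝ} (hL : profileThreshold V R ≤ L) :
    |neumannEigenvalue V L * (∫ s in Ioc 0 L, s * volterraSol (neumannCoeff V (neumannEigenvalue V L)) s) /
        (volterraSol (neumannCoeff V (neumannEigenvalue V L)) L / L) - volterraScatteringLength V R| ≤ 9 * R ^ 2 / L := by
  obtain ⟨hL', -⟩ := profileThreshold_le hV hV3 hR hL
  obtain ⟨hl0, hl1, -, -⟩ := neumannEigenvalue_spec hV hV3 hR hVR hL'
  obtain ⟨-, hlamB⟩ := abs_neumannEigenvalue_sub_le hV hV3 hR hVR hL'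
  have hD1 : 1 ≤ L - R := one_le_sub_of_threshold hL'
  obtain ⟨h16, -⟩ := threshold_le_iff_aux hL'
  obtain ⟨hα, hβ, -, -⟩ := window_data hV hV3 hR hL' hl0 hl1
  obtain ⟨-, hx⟩ := window_mul_sq_le hL' hl0 hl1
  obtain ⟨hβ0, hβRα⟩ := ground_data_le hV hV3 hR hVR hL'
  have ha := volterraScatteringLength_mem hV hV3 hR
  have haE := abs_aE_sub_a_mul_le hV hV3 hR hVR hL'
  have hRL : R ≤ L := by linarith
  have hL0 : 0 < L := by linarith
  -- the objects
  have hI := integrableOn_id_mul_neumannCoeff hV hV3 (neumannEigenvalue V L) L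
  have hmc := continuousOn_volterraSol hI
  have him : IntegrableOn (fun t => t * volterraSol (neumannCoeff V (neumannEigenvalue V L)) t) (Ioc 0 L) :=
    ((continuousOn_id.mul hmc).integrableOn_compact isCompact_Icc).mono_set Ioc_subset_Icc_self
  have hsplit : ∫ s in Ioc 0 L, s * volterraSol (neumannCoeff V (neumannEigenvalue V L)) s =
      (∫ s in Ioc 0 R, s * volterraSol (neumannCoeff V (neumannEigenvalue V L)) s) +
        ∫ s in Ioc R L, s * volterraSol (neumannCoeff V (neumannEigenvalue V L)) s := by
    rw [← setIntegral_union (Ioc_disjoint_Ioc_of_le le_rfl) measurableSet_Ioc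
      (him.mono_set (Ioc_subset_Ioc_right hRL)) (him.mono_set (Ioc_subset_Ioc_left hR.le)), Ioc_union_Ioc_eq_Ioc hR.le hRL]
  have hflux := flux_ground_outside hV hV3 hR hVR hL' (r := R) ⟨le_rfl, hRL⟩
  -- inside: `0 ≤ I_in ≤ c R³/3`
  have hIin0 : 0 ≤ ∫ s in Ioc 0 R, s * volterraSol (neumannCoeff V (neumannEigenvalue V L)) s :=
    setIntegral_nonneg measurableSet_Ioc fun s hs => mul_nonneg hs.1.le (by
      have := groundRadial_ge hV hV3 hR hVR hL' (r := s) ⟨hs.1.le, hs.2.trans hRL⟩; linarith [hs.1])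
  have hIin : ∫ s in Ioc 0 R, s * volterraSol (neumannCoeff V (neumannEigenvalue V L)) s ≤
      volterraSol (neumannCoeff V (neumannEigenvalue V L)) L / L * (R ^ 3 / 3) := by
    have hi3 : IntegrableOn (fun t : ℝ => volterraSol (neumannCoeff V (neumannEigenvalue V L)) L / L * t ^ 2) (Ioc 0 R) :=
      (Continuous.integrableOn_Icc (a := 0) (b := R) (by fun_prop)).mono_set Ioc_subset_Icc_self
    have h3 : ∫ t in Ioc 0 R, volterraSol (neumannCoeff V (neumannEigenvalue V L)) L / L * t ^ 2 =
        volterraSol (neumannCoeff V (neumannEigenvalue V L)) L / L * (R ^ 3 / 3) := by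
      rw [integral_const_mul, ← intervalIntegral.integral_of_le hR.le, integral_pow]; ring
    rw [← h3]
    refine setIntegral_mono_on (him.mono_set (Ioc_subset_Ioc_right hRL)) hi3 measurableSet_Ioc fun t ht => ?_
    have := groundRadial_le_norm_mul hV hV3 hR hVR hL (r := t) ⟨ht.1, ht.2.trans hRL⟩
    nlinarith [ht.1]
  -- the boundary value `T = m(L)` through the data at `R`
  have hT := volterraSol_neumannCoeff_tail hV hV3 hR.le hVR hl0 hRL
  rw [neumannTail] at hT
  -- make everything opaque
  set lam := neumannEigenvalue V L with hlam
  set α := volterraDeriv (neumannCoeff V lam) R with hαdef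
  set β := volterraSol (neumannCoeff V lam) R with hβdef
  set T := volterraSol (neumannCoeff V lam) L with hTdef
  set a := volterraScatteringLength V R with hadef
  set Iin := ∫ s in Ioc 0 R, s * volterraSol (neumannCoeff V lam) s with hIindef
  set Iout := ∫ s in Ioc R L, s * volterraSol (neumannCoeff V lam) s with hIoutdef
  set D := L - R with hDdef
  set x := Real.sqrt lam * D with hxdef
  clear_value lam α β T a Iin Iout D x
  have hD : 0 < D := by linarith only [hD1]
  have hLD : L = D + R := by rw [hDdef]; ring
  have hαpos : 0 < α := by linarith only [hα]
  rw [hsplit]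
  -- `λ Iout = Rα - β`
  have hout : lam * Iout = R * α - β := by linarith only [hflux]
  -- `aE`
  set aE := R - β / α with haEdef
  have haEeq : R * α - β = α * aE := by rw [haEdef]; field_simp
  have haE0 : 0 ≤ aE := by
    rw [haEdef, sub_nonneg, div_le_iff₀ hαpos]; linarith only [hβRα]
  have haER : aE ≤ R := by
    rw [haEdef]; have : 0 ≤ β / α := div_nonneg hβ0 hαpos.le; linarith only [this]
  -- window facts: `λD² ≤ 4R/L`, `λ D³ ≤ 4R`
  have hlamD2 : lam * D ^ 2 * L ≤ 4 * R := by linarith only [hlamB]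
  have hlamD3 : lam * D ^ 3 ≤ 4 * R := by
    have hDL : D ≤ L := by linarith only [hLD, hR]
    calc lam * D ^ 3 = lam * D ^ 2 * D := by ring
      _ ≤ lam * D ^ 2 * L := mul_le_mul_of_nonneg_left hDL (by positivity)
      _ ≤ 4 * R := hlamD2
  -- `|T - (β + αD)| ≤ 0.93 αR`
  have hx0 : 0 ≤ x := by rw [hxdef]; exact mul_nonneg (Real.sqrt_nonneg _) hD.le
  have hx2 : x ^ 2 = lam * D ^ 2 := by rw [hxdef, mul_pow, Real.sq_sqrt hl0]
  obtain ⟨hcos1, hsinc1⟩ := abs_cos_sub_one_le hx0 hx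
  have hTerr : |T - (β + α * D)| ≤ 93 / 100 * α * R := by
    have e : T - (β + α * D) = β * (Real.cos x - 1) + α * D * (Real.sinc x - 1) := by rw [hT]; ring
    rw [e]
    have h17 : R * 16 ≤ L := by linarith only [h16, hLD, hR]
    calc |β * (Real.cos x - 1) + α * D * (Real.sinc x - 1)| ≤ |β * (Real.cos x - 1)| + |α * D * (Real.sinc x - 1)| := abs_add_le _ _
      _ = β * |Real.cos x - 1| + α * D * |Real.sinc x - 1| := by
          simp only [abs_mul, abs_of_nonneg hβ0, abs_of_nonneg hαpos.le, abs_of_nonneg hD.le]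
      _ ≤ (R * α) * (13 / 25 * x ^ 2) + α * D * (1 / 5 * x ^ 2) := by gcongr
      _ = α * (13 / 25 * R * (lam * D ^ 2) + 1 / 5 * (lam * D ^ 3)) := by rw [hx2]; ring
      _ ≤ α * (13 / 25 * R * (4 * R / L) + 1 / 5 * (4 * R)) := by
          gcongr
          rw [le_div_iff₀ hL0]; linarith only [hlamD2]
      _ ≤ α * (13 / 25 * R * (1 / 4) + 1 / 5 * (4 * R)) := by
          have h1 : 4 * R / L ≤ 1 / 4 := by rw [div_le_iff₀ hL0]; linarith only [h17]
          gcongr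
      _ = 93 / 100 * α * R := by ring
  have hTge : 15 / 17 * α * L ≤ T := by
    have h1 := (abs_le.1 hTerr).1
    have : 16 * R ≤ D := h16
    nlinarith only [h1, this, hLD, hαpos, hβ0, hR]
  have hTpos : 0 < T := lt_of_lt_of_le (by positivity) hTge
  -- the numerator `N = λ I L - a T`
  have hQ : lam * (Iin + Iout) / (T / L) - a = (lam * Iin * L + α * L * (aE - a) + a * α * aE - a * (T - (β + α * D))) / T := by
    have hβαD : β + α * D = α * (L - aE) := by rw [haEdef, hLD]; field_simp; ring
    rw [hβαD]
    field_simp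
    have : lam * Iout = α * aE := by rw [hout, haEeq]
    linear_combination L * this
  rw [hQ, abs_div, abs_of_pos hTpos, div_le_iff₀ hTpos]
  -- bound the numerator by `7.3 α R²`
  have hN1 : |lam * Iin * L| ≤ 6 / 1000 * α * R ^ 2 := by
    rw [abs_of_nonneg (by positivity)]
    -- `λ Iin L ≤ λ (T/L)(R³/3) L = λ T R³/3 ≤ λ α (L+R) R³/3`; `λ L R³ ≤ R²/64`
    have hTle : T ≤ α * (L + R) := by
      have h1 := (abs_le.1 hTerr).2
      have : 0 ≤ α * R := by positivity
      have e : α * L = α * D + α * R := by rw [hLD]; ring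
      linarith only [h1, e, hβRα, this]
    have h2 : lam * Iin * L ≤ lam * (T / L * (R ^ 3 / 3)) * L := by gcongr
    have h3 : lam * (T / L * (R ^ 3 / 3)) * L = lam * T * R ^ 3 / 3 := by field_simp
    have h4 : lam * T * R ^ 3 / 3 ≤ lam * (α * (L + R)) * R ^ 3 / 3 := by gcongr
    have h5 : lam * L * R ^ 2 ≤ 4 * R / 256 := by
      have : (16 * R) ^ 2 ≤ D ^ 2 := pow_le_pow_left₀ (by positivity) h16 2
      have h6 : lam * L * (16 * R) ^ 2 ≤ lam * L * D ^ 2 := by gcongr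
      nlinarith only [h6, hlamD2]
    have h7 : lam * (α * (L + R)) * R ^ 3 / 3 = α * (lam * L * R ^ 2) * R / 3 + α * (lam * R ^ 2) * R ^ 2 / 3 := by ring
    have h8 : lam * R ^ 2 ≤ 4 * R / 256 / L := by
      rw [le_div_iff₀ hL0]; linarith only [h5]
    have h9 : 4 * R / 256 / L ≤ 1 / 1000 := by
      rw [div_le_iff₀ hL0]; nlinarith only [h16, hLD, hR]
    have e1 : α * (lam * L * R ^ 2) * R / 3 ≤ α * (4 * R / 256) * R / 3 := by gcongr
    have e2 : α * (lam * R ^ 2) * R ^ 2 / 3 ≤ α * (1 / 1000) * R ^ 2 / 3 := by gcongr; exact h8.trans h9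
    have e3 : α * (4 * R / 256) * R / 3 + α * (1 / 1000) * R ^ 2 / 3 ≤ 6 / 1000 * α * R ^ 2 := by
      have : 0 ≤ α * R ^ 2 := by positivity
      linarith only [this]
    linarith only [h2, h3, h4, h7, e1, e2, e3]
  have hN2 : |α * L * (aE - a)| ≤ 16 / 3 * α * R ^ 2 := by
    rw [abs_mul, abs_of_pos (by positivity), mul_assoc, mul_comm L, ← mul_assoc]
    calc α * |aE - a| * L = α * (|aE - a| * L) := by ring
      _ ≤ α * (16 / 3 * R ^ 2) := by gcongr
      _ = _ := by ring
  have hN3 : |a * α * aE| ≤ α * R ^ 2 := by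
    rw [abs_of_nonneg (by have := ha.1; positivity)]
    calc a * α * aE ≤ R * α * R := by gcongr; exact ha.2.le
      _ = α * R ^ 2 := by ring
  have hN4 : |a * (T - (β + α * D))| ≤ 93 / 100 * α * R ^ 2 := by
    rw [abs_mul, abs_of_nonneg ha.1]
    calc a * |T - (β + α * D)| ≤ R * (93 / 100 * α * R) := by gcongr; exact ha.2.le
      _ = _ := by ring
  calc |lam * Iin * L + α * L * (aE - a) + a * α * aE - a * (T - (β + α * D))|
      ≤ |lam * Iin * L| + |α * L * (aE - a)| + |a * α * aE| + |a * (T - (β + α * D))| := by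
        refine (abs_sub _ _).trans (add_le_add ((abs_add_le _ _).trans (add_le_add (abs_add_le _ _) le_rfl)) le_rfl)
    _ ≤ 6 / 1000 * α * R ^ 2 + 16 / 3 * α * R ^ 2 + α * R ^ 2 + 93 / 100 * α * R ^ 2 := by linarith only [hN1, hN2, hN3, hN4]
    _ ≤ 9 * R ^ 2 / L * (15 / 17 * α * L) := by field_simp; nlinarith only [hαpos, hR, hL0]
    _ ≤ 9 * R ^ 2 / L * T := by gcongr

end PotentialIntegral



/-! ### The normalised Neumann ground state `f_ℓ` and Lemma 2.1 (ii)–(iii) -/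

section Profile

variable {V : ℝ → ℝ≥0∞} {R : ℝ}

/-- The **normalisation constant** `c = m_λ(L)/L` (so that `f_ℓ = m_λ/(c r)` has `f_ℓ(L) = 1`).
[cite: BastiCenatiempoSchlein2021, (2.4)] -/
def neumannNorm (V : ℝ → ℝ≥0∞) (L : ℝ) : ℝ :=
  volterraSol (neumannCoeff V (neumannEigenvalue V L)) L / L

/-- **The Neumann ground state `f_ℓ`** of `-Δ + ½V` on the ball `|x| ≤ L`, as a radial profile on
`[0, ∞)`: `f_ℓ(r) = m_λ(r)/(c r)` for `0 < r ≤ L` (`c = m_λ(L)/L`, so `f_ℓ(L) = 1` and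
`f_ℓ'(L) = 0`), extended by `1` beyond `L` and by its limit `1/c` at `r ≤ 0`.
[cite: BastiCenatiempoSchlein2021, (2.4)–(2.5); BoccatoEtAl2019, (4.1)–(4.2)] -/
def neumannProfile (V : ℝ → ℝ≥0∞) (L r : ℝ) : ℝ :=
  if r ≤ 0 then 1 / neumannNorm V L
  else if r ≤ L then volterraSol (neumannCoeff V (neumannEigenvalue V L)) r / (neumannNorm V L * r)
  else 1

/-- The **flux** `J(r) = r m_λ'(r) - m_λ(r)` (`= c r² f_ℓ'(r)` on `(0, L)`). [cite: BoccatoEtAl2019, App. B] -/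
def neumannFlux (V : ℝ → ℝ≥0∞) (L r : ℝ) : ℝ :=
  r * volterraDeriv (neumannCoeff V (neumannEigenvalue V L)) r - volterraSol (neumannCoeff V (neumannEigenvalue V L)) r

/-- The derivative `f_ℓ'(r) = J(r)/(c r²)` on `(0, L)`, `0` on `[L, ∞)`. [cite: BoccatoEtAl2019, App. B] -/
def neumannProfileDeriv (V : ℝ → ℝ≥0∞) (L r : ℝ) : ℝ :=
  if r < L then neumannFlux V L r / (neumannNorm V L * r ^ 2) else 0

/-- `f_ℓ(r) = m_λ(r)/(c r)` for `0 < r ≤ L`. [folklore] -/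
theorem neumannProfile_of_mem {L r : ℝ} (hr : r ∈ Ioc 0 L) :
    neumannProfile V L r = volterraSol (neumannCoeff V (neumannEigenvalue V L)) r / (neumannNorm V L * r) := by
  simp [neumannProfile, not_le.2 hr.1, hr.2]

/-- `f_ℓ(r) = 1` for `r > L ≥ 0`. [folklore] -/
theorem neumannProfile_of_lt {L r : ℝ} (hr : L < r) (hL : 0 ≤ L) : neumannProfile V L r = 1 := by
  simp [neumannProfile, not_le.2 (hL.trans_lt hr), not_le.2 hr]

variable (hV : Measurable V) (hV3 : ∫⁻ s in Ioi (0 : ℝ), ENNReal.ofReal (s ^ 2) * V s ^ 3 ≠ ⊤)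
  (hR : 0 < R) (hVR : ∀ r, R < r → V r = 0)
include hV hV3 hR hVR

/-- `½ ≤ c ≤ (18/17)(u'(R) + ¼)`. [folklore] -/
theorem neumannNorm_bounds {L : ℝ} (hL : neumannThreshold V R ≤ L) :
    1 / 2 ≤ neumannNorm V L ∧ neumannNorm V L ≤ 18 / 17 * (volterraDeriv (neumannCoeff V 0) R + 1 / 4) :=
  ⟨(groundNorm_bounds hV hV3 hR hVR hL).1, groundNorm_le hV hV3 hR hVR hL⟩

/-- `f_ℓ(r) = 1` for `r ≥ L`. [cite: BastiCenatiempoSchlein2021, (2.4)] -/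
theorem neumannProfile_of_ge {L : ℝ} (hL : neumannThreshold V R ≤ L) {r : ℝ} (hr : L ≤ r) : neumannProfile V L r = 1 := by
  have hD1 := one_le_sub_of_threshold hL
  have hL0 : 0 < L := by linarith
  rcases hr.eq_or_lt with h | h
  · rw [← h, neumannProfile_of_mem ⟨hL0, le_rfl⟩, neumannNorm, div_mul_cancel₀ _ hL0.ne', div_self]
    have := (neumannNorm_bounds hV hV3 hR hVR hL).1
    rw [neumannNorm] at this
    intro h0; rw [h0, zero_div] at this; norm_num at this
  · exact neumannProfile_of_lt h hL0.le

omit hR hVR in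
/-- **`|m(r) - r| ≤ r(e^{G(r)} - 1)`** for the regular solution at any energy (`r ∈ [0, T]`).
[cite: LSSY2005, (2.4)] -/
theorem abs_volterraSol_neumannCoeff_sub_self_le (E : ℝ) {T r : ℝ} (hr : r ∈ Icc 0 T) :
    |volterraSol (neumannCoeff V E) r - r| ≤ r * (Real.exp (volterraWeight (neumannCoeff V E) r) - 1) := by
  have hI := integrableOn_id_mul_neumannCoeff hV hV3 E T
  have hBc : ContinuousOn (fun s => Real.exp (volterraWeight (neumannCoeff V E) s)) (Icc 0 T) :=
    (continuousOn_volterraWeight hI).rexp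
  have h1 := abs_setIntegral_kernel_mul_le (m := volterraSol (neumannCoeff V E)) hI hBc
    (fun s hs => abs_volterraSol_le hI (Ioc_subset_Icc_self hs)) hr
  have h2 : ∫ s in Ioc 0 r, s * |neumannCoeff V E s| * Real.exp (volterraWeight (neumannCoeff V E) s) =
      Real.exp (volterraWeight (neumannCoeff V E) r) - 1 := by
    have h3 := setIntegral_mul_exp_primitive hr.1 ((integrableOn_posPart_mul_abs hI).mono_set (Ioc_subset_Ioc_right hr.2))
    have h4 : volterraWeight (neumannCoeff V E) r = ∫ t in Ioc 0 r, max t 0 * |neumannCoeff V E t| := rfl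
    rw [h4, ← h3]
    refine setIntegral_congr_fun measurableSet_Ioc fun s hs => ?_
    simp only [volterraWeight, max_eq_left hs.1.le]
  rw [h2] at h1
  rw [volterraSol_eq hI hr, add_sub_cancel_left]
  exact h1

omit hR hVR in
/-- **`m(r)/r → 1` as `r → 0+`** for the regular solution at any energy. [cite: LSSY2005, (2.4)] -/
theorem tendsto_volterraSol_neumannCoeff_div (E : ℝ) :
    Tendsto (fun r => volterraSol (neumannCoeff V E) r / r) (𝓝[>] 0) (𝓝 1) := by
  have hI := integrableOn_id_mul_neumannCoeff hV hV3 E 1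
  have hG := continuousOn_volterraWeight hI
  -- `|m(r)/r - 1| ≤ e^{G(r)} - 1 → 0`
  have hG0 : Tendsto (fun r => Real.exp (volterraWeight (neumannCoeff V E) r) - 1) (𝓝[>] 0) (𝓝 0) := by
    have h1 : ContinuousWithinAt (fun r => Real.exp (volterraWeight (neumannCoeff V E) r) - 1) (Icc 0 1) 0 :=
      ((hG 0 ⟨le_rfl, zero_le_one⟩).rexp).sub continuousWithinAt_const
    have h2 : Real.exp (volterraWeight (neumannCoeff V E) 0) - 1 = 0 := by
      simp [volterraWeight]
    rw [ContinuousWithinAt, h2] at h1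
    have h3 := h1.mono_left (nhdsWithin_mono 0 (Ioc_subset_Icc_self : Ioc (0 : ℝ) 1 ⊆ Icc 0 1))
    rwa [nhdsWithin_Ioc_eq_nhdsGT zero_lt_one] at h3
  refine (tendsto_iff_norm_sub_tendsto_zero).2 (squeeze_zero_norm' ?_ hG0)
  filter_upwards [Ioc_mem_nhdsGT zero_lt_one] with r hr
  rw [norm_norm, Real.norm_eq_abs]
  have h := abs_volterraSol_neumannCoeff_sub_self_le hV hV3 E (T := 1) (Ioc_subset_Icc_self hr)
  have h3 : volterraSol (neumannCoeff V E) r / r - 1 = (volterraSol (neumannCoeff V E) r - r) / r := by field_simp [hr.1.ne']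
  rw [h3, abs_div, abs_of_pos hr.1, div_le_iff₀ hr.1]
  linarith

/-- **`c ≥ 1`**: the normalisation constant dominates `lim_{r→0} m_λ(r)/r = 1` (`m_λ ≤ c r`).
[cite: ErdosSchleinYau2006, Lemma A.1 (ii) (`φ ≤ 1`)] -/
theorem one_le_neumannNorm {L : ℝ} (hL : profileThreshold V R ≤ L) : 1 ≤ neumannNorm V L := by
  obtain ⟨hL', -⟩ := profileThreshold_le hV hV3 hR hL
  have hD1 := one_le_sub_of_threshold hL'
  have hL0 : 0 < L := by linarith
  refine le_of_tendsto (tendsto_volterraSol_neumannCoeff_div hV hV3 (neumannEigenvalue V L)) ?_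
  filter_upwards [Ioc_mem_nhdsGT hL0] with r hr
  rw [div_le_iff₀ hr.1]
  exact groundRadial_le_norm_mul hV hV3 hR hVR hL hr

/-- **Lemma 2.1 (ii), first half: `0 ≤ f_ℓ ≤ 1`** (for `L ≥ L₀'`, all `r`).
[cite: BastiCenatiempoSchlein2021, Lemma 2.1 (ii); BoccatoEtAl2019, Lemma 4.1 (ii)] -/
theorem neumannProfile_mem_Icc {L : ℝ} (hL : profileThreshold V R ≤ L) (r : ℝ) : neumannProfile V L r ∈ Icc 0 1 := by
  obtain ⟨hL', -⟩ := profileThreshold_le hV hV3 hR hL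
  have hc1 := one_le_neumannNorm hV hV3 hR hVR hL
  have hc : 0 < neumannNorm V L := by linarith
  have hD1 := one_le_sub_of_threshold hL'
  have hL0 : 0 < L := by linarith
  rcases le_or_gt r 0 with h0 | h0
  · simp only [neumannProfile, h0, if_true]
    refine ⟨by positivity, ?_⟩
    rw [div_le_one hc]; exact hc1
  rcases le_or_gt r L with hrL | hrL
  · rw [neumannProfile_of_mem ⟨h0, hrL⟩]
    refine ⟨div_nonneg ?_ (by positivity), ?_⟩
    · have := groundRadial_ge hV hV3 hR hVR hL' (r := r) ⟨h0.le, hrL⟩; linarith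
    · rw [div_le_one (by positivity)]
      exact groundRadial_le_norm_mul hV hV3 hR hVR hL ⟨h0, hrL⟩
  · rw [neumannProfile_of_lt hrL hL0.le]
    exact ⟨zero_le_one, le_rfl⟩

/-- **The flux beyond the range is bounded**: `0 ≤ J(r) ≤ λ c L³/3` on `[R, L]` for `L ≥ L₀'`
(`J(r) = λ∫_r^L s m_λ ≤ λ c ∫ s²`). [cite: BoccatoEtAl2019, App. B (proof of Lemma 4.1 (iii))] -/
theorem neumannFlux_outside_mem {L : ℝ} (hL : profileThreshold V R ≤ L) {r : ℝ} (hr : r ∈ Icc R L) :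
    0 ≤ neumannFlux V L r ∧ neumannFlux V L r ≤ neumannEigenvalue V L * neumannNorm V L * L ^ 3 / 3 := by
  obtain ⟨hL', -⟩ := profileThreshold_le hV hV3 hR hL
  obtain ⟨hl0, -, -, -⟩ := neumannEigenvalue_spec hV hV3 hR hVR hL'
  obtain ⟨hc0, -⟩ := neumannNorm_bounds hV hV3 hR hVR hL'
  have hr0 : 0 ≤ r := hR.le.trans hr.1
  have h1 := flux_ground_outside_ge hV hV3 hR hVR hL' hr
  refine ⟨le_trans (mul_nonneg hl0 (div_nonneg (by nlinarith [pow_le_pow_left₀ hr0 hr.2 3]) (by norm_num))) h1, ?_⟩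
  rw [neumannFlux, flux_ground_outside hV hV3 hR hVR hL' hr]
  have hI := integrableOn_id_mul_neumannCoeff hV hV3 (neumannEigenvalue V L) L
  have hmc := continuousOn_volterraSol hI
  have him : IntegrableOn (fun t => t * volterraSol (neumannCoeff V (neumannEigenvalue V L)) t) (Ioc r L) := by
    have hc : ContinuousOn (fun t => t * volterraSol (neumannCoeff V (neumannEigenvalue V L)) t) (Icc r L) :=
      continuousOn_id.mul (hmc.mono (Icc_subset_Icc_left hr0))
    exact (hc.integrableOn_compact isCompact_Icc).mono_set Ioc_subset_Icc_self
  have hi3 : IntegrableOn (fun t : ℝ => neumannNorm V L * t ^ 2) (Ioc r L) :=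
    (Continuous.integrableOn_Icc (a := r) (b := L) (by fun_prop)).mono_set Ioc_subset_Icc_self
  have h2 : ∫ t in Ioc r L, t * volterraSol (neumannCoeff V (neumannEigenvalue V L)) t ≤ neumannNorm V L * L ^ 3 / 3 := by
    have h3 : ∫ t in Ioc r L, neumannNorm V L * t ^ 2 = neumannNorm V L * ((L ^ 3 - r ^ 3) / 3) := by
      rw [integral_const_mul, ← intervalIntegral.integral_of_le hr.2, integral_pow]; ring
    calc ∫ t in Ioc r L, t * volterraSol (neumannCoeff V (neumannEigenvalue V L)) t ≤ ∫ t in Ioc r L, neumannNorm V L * t ^ 2 := by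
          refine setIntegral_mono_on him hi3 measurableSet_Ioc fun t ht => ?_
          have := groundRadial_le_norm_mul hV hV3 hR hVR hL (r := t) ⟨hr0.trans_lt ht.1, ht.2⟩
          rw [← neumannNorm] at this
          nlinarith [ht.1]
      _ = neumannNorm V L * ((L ^ 3 - r ^ 3) / 3) := h3
      _ ≤ neumannNorm V L * L ^ 3 / 3 := by nlinarith [pow_nonneg hr0 3]
  calc neumannEigenvalue V L * ∫ t in Ioc r L, t * volterraSol (neumannCoeff V (neumannEigenvalue V L)) t
      ≤ neumannEigenvalue V L * (neumannNorm V L * L ^ 3 / 3) := mul_le_mul_of_nonneg_left h2 hl0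
    _ = _ := by ring

/-- **The flux inside the range is bounded**: `|J(r)| ≤ c((K/6 + 1/9) r² + λ r³/3)` on `(0, R]`
for `L ≥ L₀'` (`|J| ≤ ½∫₀ʳ sVm + λ∫₀ʳ sm`, `0 ≤ m ≤ cs`, `∫₀ʳ s²V ≤ (K/3 + 2/9)r²`).
[cite: BoccatoEtAl2019, App. B (proof of Lemma 4.1 (iii): `|f'(r)| ≤ C(‖V‖₃ + 1)`)] -/
theorem abs_neumannFlux_inside_le {L : ℝ} (hL : profileThreshold V R ≤ L) {r : ℝ} (hr : r ∈ Ioc 0 R) :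
    |neumannFlux V L r| ≤ neumannNorm V L * ((radialL3 V / 6 + 1 / 9) * r ^ 2 + neumannEigenvalue V L * r ^ 3 / 3) := by
  obtain ⟨hL', -⟩ := profileThreshold_le hV hV3 hR hL
  obtain ⟨hl0, -, -, -⟩ := neumannEigenvalue_spec hV hV3 hR hVR hL'
  obtain ⟨hc0, -⟩ := neumannNorm_bounds hV hV3 hR hVR hL'
  have hD1 := one_le_sub_of_threshold hL'
  have hrL : r ≤ L := by linarith [hr.2]
  set lam := neumannEigenvalue V L with hlam
  set c := neumannNorm V L with hcdef
  have hcpos : 0 < c := by linarith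
  have hI := integrableOn_id_mul_neumannCoeff hV hV3 lam r
  have hmc := continuousOn_volterraSol hI
  have hmb : ∀ t ∈ Icc 0 r, |volterraSol (neumannCoeff V lam) t| ≤ Real.exp (volterraWeight (neumannCoeff V lam) r) * t :=
    fun t ht => abs_volterraSol_le_mul hI ht
  have hI0 := integrableOn_id_mul_neumannCoeff hV hV3 0 r
  have hiV : IntegrableOn (fun t => t * (neumannCoeff V 0 t * volterraSol (neumannCoeff V lam) t)) (Ioc 0 r) :=
    integrableOn_id_mul_coeff_mul hI0 hmc hmb
  have him : IntegrableOn (fun t => t * volterraSol (neumannCoeff V lam) t) (Ioc 0 r) :=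
    ((continuousOn_id.mul hmc).integrableOn_compact isCompact_Icc).mono_set Ioc_subset_Icc_self
  have hm0 : ∀ t ∈ Ioc 0 r, 0 ≤ volterraSol (neumannCoeff V lam) t := fun t ht => by
    have := groundRadial_ge hV hV3 hR hVR hL' (r := t) ⟨ht.1.le, ht.2.trans hrL⟩
    rw [← hlam] at this; linarith [ht.1]
  have hmc' : ∀ t ∈ Ioc 0 r, volterraSol (neumannCoeff V lam) t ≤ c * t := fun t ht => by
    have := groundRadial_le_norm_mul hV hV3 hR hVR hL (r := t) ⟨ht.1, ht.2.trans hrL⟩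
    rwa [← hlam, ← neumannNorm, ← hcdef] at this
  rw [neumannFlux, ← hlam, flux_eq hV hV3 lam hr.1.le]
  have hsplit : ∫ t in Ioc 0 r, t * (neumannCoeff V lam t * volterraSol (neumannCoeff V lam) t) =
      (∫ t in Ioc 0 r, t * (neumannCoeff V 0 t * volterraSol (neumannCoeff V lam) t)) -
        lam * ∫ t in Ioc 0 r, t * volterraSol (neumannCoeff V lam) t := by
    rw [← integral_const_mul, ← integral_sub hiV (him.const_mul lam)]
    refine setIntegral_congr_fun measurableSet_Ioc fun t _ => ?_
    simp only [neumannCoeff, sub_zero]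
    ring
  rw [hsplit]
  -- `0 ≤ ∫ t ½V m ≤ (c/2)∫ t²V ≤ (c/2)(K/3 + 2/9) r²`
  have hVint := setIntegral_sq_mul_pot_le hV hV3 hr.1
  have hA0 : 0 ≤ ∫ t in Ioc 0 r, t * (neumannCoeff V 0 t * volterraSol (neumannCoeff V lam) t) :=
    setIntegral_nonneg measurableSet_Ioc fun t ht => mul_nonneg ht.1.le (mul_nonneg (neumannCoeff_zero_nonneg V t) (hm0 t ht))
  have hA : ∫ t in Ioc 0 r, t * (neumannCoeff V 0 t * volterraSol (neumannCoeff V lam) t) ≤ c / 2 * ((radialL3 V / 3 + 2 / 9) * r ^ 2) := by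
    have hi4 : IntegrableOn (fun t => c / 2 * (t ^ 2 * (V t).toReal)) (Ioc 0 r) := by
      have h1 : IntegrableOn (fun t => t ^ 2 * (V t).toReal) (Ioc 0 r) := by
        have h2 := integrableOn_id_mul_pot hV hV3 r
        refine Integrable.mono' (h2.norm.const_mul r) (((measurable_id.pow_const 2).mul hV.ennreal_toReal).aestronglyMeasurable) ?_
        filter_upwards [ae_restrict_mem measurableSet_Ioc] with t ht
        have ht0 : 0 ≤ t := ht.1.le
        have hr0 : 0 ≤ r := hr.1.le
        rw [Real.norm_eq_abs, abs_of_nonneg (by positivity), Real.norm_eq_abs, abs_of_nonneg (by positivity)]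
        have : t ^ 2 * (V t).toReal = t * (t * (V t).toReal) := by ring
        rw [this]
        exact mul_le_mul_of_nonneg_right ht.2 (by positivity)
      exact h1.const_mul _
    calc ∫ t in Ioc 0 r, t * (neumannCoeff V 0 t * volterraSol (neumannCoeff V lam) t)
        ≤ ∫ t in Ioc 0 r, c / 2 * (t ^ 2 * (V t).toReal) := by
          refine setIntegral_mono_on hiV hi4 measurableSet_Ioc fun t ht => ?_
          simp only [neumannCoeff, sub_zero]
          have h1 := hmc' t ht
          have ht0 : 0 ≤ t := ht.1.le
          have h2 : 0 ≤ t * (V t).toReal := by positivity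
          nlinarith [mul_le_mul_of_nonneg_left h1 h2]
      _ = c / 2 * ∫ t in Ioc 0 r, t ^ 2 * (V t).toReal := integral_const_mul _ _
      _ ≤ c / 2 * ((radialL3 V / 3 + 2 / 9) * r ^ 2) := mul_le_mul_of_nonneg_left hVint (by linarith)
  have hB0 : 0 ≤ ∫ t in Ioc 0 r, t * volterraSol (neumannCoeff V lam) t :=
    setIntegral_nonneg measurableSet_Ioc fun t ht => mul_nonneg ht.1.le (hm0 t ht)
  have hB : ∫ t in Ioc 0 r, t * volterraSol (neumannCoeff V lam) t ≤ c * r ^ 3 / 3 := by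
    have hi3 : IntegrableOn (fun t : ℝ => c * t ^ 2) (Ioc 0 r) :=
      (Continuous.integrableOn_Icc (a := 0) (b := r) (by fun_prop)).mono_set Ioc_subset_Icc_self
    have h3 : ∫ t in Ioc 0 r, c * t ^ 2 = c * r ^ 3 / 3 := by
      rw [integral_const_mul, ← intervalIntegral.integral_of_le hr.1.le, integral_pow]; ring
    rw [← h3]
    refine setIntegral_mono_on him hi3 measurableSet_Ioc fun t ht => ?_
    nlinarith [hmc' t ht, ht.1]
  rw [abs_le]
  constructor
  · nlinarith [mul_le_mul_of_nonneg_left hB hl0, radialL3_nonneg (V := V)]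
  · nlinarith [mul_nonneg hl0 hB0, radialL3_nonneg (V := V)]

/-- **Lemma 2.1 (iii), first bound: `w_ℓ = 1 - f_ℓ ≤ C/(|x| + 1)`**, explicitly
`0 ≤ 1 - f_ℓ(r) ≤ (2R + 1)/(r + 1)` for all `r ≥ 0` and `L ≥ L₀'` (beyond the range
`c - m_λ/r ≤ λcL³/(3r) ≤ 1.51Rc/r` by `J ≤ λcL³/3`; inside `1 - f_ℓ ≤ 1`).
[cite: BastiCenatiempoSchlein2021, Lemma 2.1 (iii); BoccatoEtAl2019, Lemma 4.1 (iii) (4.7); ErdosSchleinYau2006, Lemma A.1 (ii) (A.2)] -/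
theorem one_sub_neumannProfile_mem {L : ℝ} (hL : profileThreshold V R ≤ L) {r : ℝ} (hr : 0 ≤ r) :
    0 ≤ 1 - neumannProfile V L r ∧ 1 - neumannProfile V L r ≤ (2 * R + 1) / (r + 1) := by
  obtain ⟨hL', -⟩ := profileThreshold_le hV hV3 hR hL
  obtain ⟨hl0, hl1, -, -⟩ := neumannEigenvalue_spec hV hV3 hR hVR hL'
  obtain ⟨-, hlamB⟩ := abs_neumannEigenvalue_sub_le hV hV3 hR hVR hL'
  obtain ⟨h16, -⟩ := threshold_le_iff_aux hL'
  have hD1 := one_le_sub_of_threshold hL'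
  have hL0 : 0 < L := by linarith
  have hf := neumannProfile_mem_Icc hV hV3 hR hVR hL r
  refine ⟨by linarith [hf.2], ?_⟩
  have hc1 := one_le_neumannNorm hV hV3 hR hVR hL
  have hc : 0 < neumannNorm V L := by linarith
  -- the easy cases `r ≤ 2R` (where `1 - f ≤ 1 ≤ (2R+1)/(r+1)`) and `r ≥ L` (where `f = 1`)
  by_cases h2R : r ≤ 2 * R
  · rw [le_div_iff₀ (by linarith)]; nlinarith [hf.1]
  rw [not_le] at h2R
  rcases le_or_gt L r with hrL | hrL
  · rw [neumannProfile_of_ge hV hV3 hR hVR hL' hrL]; simp; positivity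
  -- `2R < r < L`: `c - m/r ≤ λ c L³/(3r)`
  have hRr : R ≤ r := by linarith
  have hr0 : 0 < r := by linarith
  set lam := neumannEigenvalue V L with hlam
  set c := neumannNorm V L with hcdef
  set K := lam * c * L ^ 3 / 3 with hK
  have hK0 : 0 ≤ K := by positivity
  -- `H(s) = m(s)/s + K s⁻¹` is antitone on `[r, L]`
  set H : ℝ → ℝ := fun s => volterraSol (neumannCoeff V lam) s / s + K * s⁻¹ with hH
  have hdH : ∀ s, 0 < s → HasDerivAt H
      ((s * volterraDeriv (neumannCoeff V lam) s - volterraSol (neumannCoeff V lam) s) / s ^ 2 + K * (-(s ^ 2)⁻¹)) s :=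
    fun s hs => (hasDerivAt_profile hV hV3 lam hs).add ((hasDerivAt_inv hs.ne').const_mul K)
  have hanti : AntitoneOn H (Icc r L) := by
    refine antitoneOn_of_deriv_nonpos (convex_Icc r L) ?_ ?_ ?_
    · exact fun s hs => (hdH s (hr0.trans_le hs.1)).continuousAt.continuousWithinAt
    · intro s hs
      rw [interior_Icc] at hs
      exact (hdH s (hr0.trans hs.1)).differentiableAt.differentiableWithinAt
    · intro s hs
      rw [interior_Icc] at hs
      have hs0 : 0 < s := hr0.trans hs.1
      rw [(hdH s hs0).deriv]
      have hJ := (neumannFlux_outside_mem hV hV3 hR hVR hL (r := s) ⟨hRr.trans hs.1.le, hs.2.le⟩).2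
      rw [neumannFlux, ← hlam, ← hcdef] at hJ
      have e : (s * volterraDeriv (neumannCoeff V lam) s - volterraSol (neumannCoeff V lam) s) / s ^ 2 + K * (-(s ^ 2)⁻¹) =
          ((s * volterraDeriv (neumannCoeff V lam) s - volterraSol (neumannCoeff V lam) s) - K) / s ^ 2 := by
        field_simp; ring
      rw [e]
      exact div_nonpos_of_nonpos_of_nonneg (by rw [hK]; linarith) (sq_nonneg _)
  have h1 := hanti ⟨le_rfl, hrL.le⟩ ⟨hrL.le, le_rfl⟩ hrL.le
  simp only [hH] at h1
  have hcL : volterraSol (neumannCoeff V lam) L / L = c := rfl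
  rw [hcL] at h1
  -- `c - m(r)/r ≤ K (1/r - 1/L) ≤ K/r`, and `K/c = λ L³/3 ≤ 1.51 R`
  have h2 : c - volterraSol (neumannCoeff V lam) r / r ≤ K / r := by
    have : 0 ≤ K * L⁻¹ := by positivity
    rw [show K / r = K * r⁻¹ from div_eq_mul_inv K r]; linarith
  have hlamL3 : lam * L ^ 3 ≤ 5 * R := by
    -- `λ L³ = λ D²L (L/D)² ≤ 4R (17/16)²`
    have hD : 0 < L - R := by linarith
    have h3 : L ≤ 17 / 16 * (L - R) := by linarith
    have h4 : L ^ 2 ≤ (17 / 16 * (L - R)) ^ 2 := pow_le_pow_left₀ hL0.le h3 2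
    calc lam * L ^ 3 = lam * L ^ 2 * L := by ring
      _ ≤ lam * (17 / 16 * (L - R)) ^ 2 * L := by gcongr
      _ = (17 / 16) ^ 2 * (lam * ((L - R) ^ 2 * L)) := by ring
      _ ≤ (17 / 16) ^ 2 * (4 * R) := by gcongr
      _ ≤ 5 * R := by linarith
  rw [neumannProfile_of_mem ⟨hr0, hrL.le⟩, ← hlam, ← hcdef]
  have h5 : 1 - volterraSol (neumannCoeff V lam) r / (c * r) = (c - volterraSol (neumannCoeff V lam) r / r) / c := by
    field_simp
  rw [h5, div_le_iff₀ hc]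
  calc c - volterraSol (neumannCoeff V lam) r / r ≤ K / r := h2
    _ = lam * L ^ 3 / 3 / r * c := by rw [hK]; field_simp
    _ ≤ 5 * R / 3 / r * c := by gcongr
    _ ≤ (2 * R + 1) / (r + 1) * c := by
        refine mul_le_mul_of_nonneg_right ?_ hc.le
        rw [div_le_div_iff₀ hr0 (by linarith)]
        nlinarith

omit hV hV3 hR hVR in
/-- `f_ℓ` agrees with `m_λ/(c r)` near every point of `(0, L)`. [folklore] -/
theorem neumannProfile_eventuallyEq {L r : ℝ} (hr : r ∈ Ioo 0 L) :
    neumannProfile V L =ᶠ[𝓝 r] fun ρ => (neumannNorm V L)⁻¹ * (volterraSol (neumannCoeff V (neumannEigenvalue V L)) ρ / ρ) := by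
  filter_upwards [Ioo_mem_nhds hr.1 hr.2] with ρ hρ
  rw [neumannProfile_of_mem ⟨hρ.1, hρ.2.le⟩]
  field_simp

omit hVR in
/-- **`f_ℓ` is differentiable on `(0, ∞)`** with derivative `neumannProfileDeriv` (`J/(cr²)` on
`(0, L)`, `0` from `L` on; at `L` both one-sided derivatives vanish by the Neumann condition).
[cite: BastiCenatiempoSchlein2021, (2.4)–(2.5); BoccatoEtAl2019, App. B] -/
theorem hasDerivAt_neumannProfile (hVR : ∀ r, R < r → V r = 0) {L : ℝ} (hL : neumannThreshold V R ≤ L) {r : ℝ}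
    (hr : 0 < r) : HasDerivAt (neumannProfile V L) (neumannProfileDeriv V L r) r := by
  obtain ⟨-, -, hg, -⟩ := neumannEigenvalue_spec hV hV3 hR hVR hL
  have hD1 := one_le_sub_of_threshold hL
  have hL0 : 0 < L := by linarith
  have hinside : ∀ ρ, 0 < ρ → HasDerivAt (fun ρ => (neumannNorm V L)⁻¹ * (volterraSol (neumannCoeff V (neumannEigenvalue V L)) ρ / ρ))
      (neumannFlux V L ρ / (neumannNorm V L * ρ ^ 2)) ρ := by
    intro ρ hρ
    have h := (hasDerivAt_profile hV hV3 (neumannEigenvalue V L) hρ).const_mul (neumannNorm V L)⁻¹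
    refine h.congr_deriv ?_
    rw [neumannFlux]
    field_simp
  rcases lt_trichotomy r L with hrL | hrL | hrL
  · -- interior
    rw [neumannProfileDeriv, if_pos hrL]
    exact (hinside r hr).congr_of_eventuallyEq (neumannProfile_eventuallyEq ⟨hr, hrL⟩)
  · -- at `L`: both one-sided derivatives are `0`
    subst hrL
    rw [neumannProfileDeriv, if_neg (lt_irrefl _)]
    have hJ : neumannFlux V r r = 0 := hg
    have hval : neumannProfile V r r = 1 := neumannProfile_of_ge hV hV3 hR hVR hL le_rfl
    have hleft : HasDerivWithinAt (neumannProfile V r) 0 (Iic r) r := by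
      have h1 := (hinside r hr).hasDerivWithinAt (s := Iic r)
      rw [hJ, zero_div] at h1
      refine h1.congr_of_eventuallyEq ?_ ?_
      · filter_upwards [inter_mem_nhdsWithin (Iic r) (Ioi_mem_nhds hr)] with ρ hρ
        rw [neumannProfile_of_mem ⟨hρ.2, hρ.1⟩]
        field_simp
      · rw [neumannProfile_of_mem ⟨hr, le_rfl⟩]
        field_simp
    have hright : HasDerivWithinAt (neumannProfile V r) 0 (Ici r) r := by
      refine (hasDerivWithinAt_const r (Ici r) (1 : ℝ)).congr_of_eventuallyEq ?_ hval
      filter_upwards [self_mem_nhdsWithin] with ρ hρ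
      exact neumannProfile_of_ge hV hV3 hR hVR hL hρ
    have h := hleft.union hright
    rwa [Iic_union_Ici, hasDerivWithinAt_univ] at h
  · -- beyond `L`: locally constant
    rw [neumannProfileDeriv, if_neg (not_lt.2 hrL.le)]
    refine (hasDerivAt_const r (1 : ℝ)).congr_of_eventuallyEq ?_
    filter_upwards [Ioi_mem_nhds hrL] with ρ hρ
    exact neumannProfile_of_lt hρ hL0.le

/-- `f_ℓ` is continuous on `(0, ∞)`. [folklore] -/
theorem continuousAt_neumannProfile {L : ℝ} (hL : neumannThreshold V R ≤ L) {r : ℝ} (hr : 0 < r) :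
    ContinuousAt (neumannProfile V L) r :=
  (hasDerivAt_neumannProfile hV hV3 hR hVR hL hr).continuousAt

omit hVR in
/-- **`f_ℓ` is continuous at the origin from the right** (`m_λ(r)/r → 1`, `f_ℓ(0) = 1/c`). [folklore] -/
theorem continuousWithinAt_neumannProfile_zero {L : ℝ} (hL : neumannThreshold V R ≤ L) :
    ContinuousWithinAt (neumannProfile V L) (Ici 0) 0 := by
  have hD1 := one_le_sub_of_threshold hL
  have hL0 : 0 < L := by linarith
  have h0 : neumannProfile V L 0 = 1 / neumannNorm V L := by simp [neumannProfile]
  rw [ContinuousWithinAt, h0]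
  have h1 := (tendsto_volterraSol_neumannCoeff_div hV hV3 (neumannEigenvalue V L)).const_mul (neumannNorm V L)⁻¹
  rw [mul_one, inv_eq_one_div] at h1
  have h2 : Tendsto (neumannProfile V L) (𝓝[>] 0) (𝓝 (1 / neumannNorm V L)) := by
    refine h1.congr' ?_
    filter_upwards [Ioc_mem_nhdsGT hL0] with ρ hρ
    rw [neumannProfile_of_mem hρ]
    field_simp
  -- `𝓝[Ici 0] 0 = pure 0 ⊔ 𝓝[>] 0`
  rw [← Ioi_insert, nhdsWithin_insert, tendsto_sup]
  exact ⟨tendsto_pure_nhds _ _ |>.mono_right (by rw [h0]), h2⟩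


/-- `f_ℓ` is continuous on `[0, ∞)`. [folklore] -/
theorem continuousOn_neumannProfile {L : ℝ} (hL : neumannThreshold V R ≤ L) :
    ContinuousOn (neumannProfile V L) (Ici 0) := by
  intro r hr
  rcases (mem_Ici.1 hr).eq_or_lt with h | h
  · rw [← h]; exact continuousWithinAt_neumannProfile_zero hV hV3 hR hL
  · exact (continuousAt_neumannProfile hV hV3 hR hVR hL h).continuousWithinAt

/-- **`λ_ℓ L³ ≤ 5R`** for `L ≥ L₀` (`λ_ℓ (L-R)² L ≤ 4R` and `L ≤ (17/16)(L - R)`).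
[cite: ErdosSchleinYau2006, Lemma A.1 (i) (A.1)] -/
theorem neumannEigenvalue_mul_cube_le {L : ℝ} (hL : neumannThreshold V R ≤ L) :
    neumannEigenvalue V L * L ^ 3 ≤ 5 * R := by
  obtain ⟨hl0, -, -, -⟩ := neumannEigenvalue_spec hV hV3 hR hVR hL
  obtain ⟨-, hlamB⟩ := abs_neumannEigenvalue_sub_le hV hV3 hR hVR hL
  obtain ⟨h16, -⟩ := threshold_le_iff_aux hL
  have hD1 := one_le_sub_of_threshold hL
  have hL0 : 0 < L := by linarith
  have h3 : L ≤ 17 / 16 * (L - R) := by linarith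
  have h4 : L ^ 2 ≤ (17 / 16 * (L - R)) ^ 2 := pow_le_pow_left₀ hL0.le h3 2
  calc neumannEigenvalue V L * L ^ 3 = neumannEigenvalue V L * L ^ 2 * L := by ring
    _ ≤ neumannEigenvalue V L * (17 / 16 * (L - R)) ^ 2 * L := by gcongr
    _ = (17 / 16) ^ 2 * (neumannEigenvalue V L * ((L - R) ^ 2 * L)) := by ring
    _ ≤ (17 / 16) ^ 2 * (4 * R) := by gcongr
    _ ≤ 5 * R := by linarith

/-- **`λ_ℓ R ≤ 1/64`** for `L ≥ L₀` (`λ_ℓ (L-R)² L ≤ 4R`, `L - R ≥ 16R`, `L ≥ 1`). [folklore] -/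
theorem neumannEigenvalue_mul_range_le {L : ℝ} (hL : neumannThreshold V R ≤ L) :
    neumannEigenvalue V L * R ≤ 1 / 64 := by
  obtain ⟨hl0, -, -, -⟩ := neumannEigenvalue_spec hV hV3 hR hVR hL
  obtain ⟨-, hlamB⟩ := abs_neumannEigenvalue_sub_le hV hV3 hR hVR hL
  obtain ⟨h16, -⟩ := threshold_le_iff_aux hL
  have hD1 := one_le_sub_of_threshold hL
  have hL1 : 1 ≤ L := by linarith
  have hDL : 0 < (L - R) ^ 2 * L := by positivity
  refine le_of_mul_le_mul_right ?_ hDL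
  have h256 : (16 * R) ^ 2 ≤ (L - R) ^ 2 := pow_le_pow_left₀ (by positivity) h16 2
  have h5 := mul_le_mul h256 hL1 zero_le_one (sq_nonneg (L - R))
  calc neumannEigenvalue V L * R * ((L - R) ^ 2 * L) = R * (neumannEigenvalue V L * ((L - R) ^ 2 * L)) := by ring
    _ ≤ R * (4 * R) := by gcongr
    _ = 1 / 64 * ((16 * R) ^ 2 * 1) := by ring
    _ ≤ 1 / 64 * ((L - R) ^ 2 * L) := by linarith

/-- **Lemma 2.1 (iii) inside the range: `|f_ℓ'(r)| ≤ K/6 + 1/8`** for `0 < r ≤ R` and `L ≥ L₀'`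
(`f_ℓ' = J/(cr²)`, `|J| ≤ c((K/6 + 1/9)r² + λr³/3)`, `λR ≤ 1/64`; `K = ∫₀^∞ V³s²`).
[cite: BoccatoEtAl2019, Lemma 4.1 (iii), App. B (`|f'(r)| ≤ C(‖V‖₃ + 1)` inside the range)] -/
theorem abs_neumannProfileDeriv_inside_le {L : ℝ} (hL : profileThreshold V R ≤ L) {r : ℝ} (hr : r ∈ Ioc 0 R) :
    |neumannProfileDeriv V L r| ≤ radialL3 V / 6 + 1 / 8 := by
  obtain ⟨hL', -⟩ := profileThreshold_le hV hV3 hR hL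
  obtain ⟨hl0, -, -, -⟩ := neumannEigenvalue_spec hV hV3 hR hVR hL'
  have hD1 := one_le_sub_of_threshold hL'
  have hrL : r < L := by linarith [hr.2]
  have hc1 := one_le_neumannNorm hV hV3 hR hVR hL
  have hc : 0 < neumannNorm V L := by linarith
  have hJ := abs_neumannFlux_inside_le hV hV3 hR hVR hL hr
  have hlamR := neumannEigenvalue_mul_range_le hV hV3 hR hVR hL'
  have hK := radialL3_nonneg (V := V)
  have hr0 := hr.1
  rw [neumannProfileDeriv, if_pos hrL, abs_div, abs_of_pos (by positivity : 0 < neumannNorm V L * r ^ 2),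
    div_le_iff₀ (by positivity)]
  refine hJ.trans ?_
  have hlamr : neumannEigenvalue V L * r ≤ 1 / 64 := le_trans (mul_le_mul_of_nonneg_left hr.2 hl0) hlamR
  have h1 : neumannEigenvalue V L * r * r ^ 2 ≤ 1 / 64 * r ^ 2 := mul_le_mul_of_nonneg_right hlamr (sq_nonneg r)
  have h2 : neumannEigenvalue V L * r ^ 3 / 3 ≤ 1 / 72 * r ^ 2 := by nlinarith [h1, sq_nonneg r]
  have h3 := mul_le_mul_of_nonneg_left h2 hc.le
  nlinarith [h3, hc, hK, sq_nonneg r]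

/-- **Lemma 2.1 (iii) beyond the range: `0 ≤ f_ℓ'(r) ≤ 5R/(3r²)`** for `r ≥ R` and `L ≥ L₀'`
(`0 ≤ J ≤ λcL³/3` on `[R, L]`, `λL³ ≤ 5R`; `f_ℓ' = 0` from `L` on).
[cite: BoccatoEtAl2019, Lemma 4.1 (iii), App. B (last display)] -/
theorem neumannProfileDeriv_outside_mem {L : ℝ} (hL : profileThreshold V R ≤ L) {r : ℝ} (hr : R ≤ r) :
    0 ≤ neumannProfileDeriv V L r ∧ neumannProfileDeriv V L r ≤ 5 * R / (3 * r ^ 2) := by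
  obtain ⟨hL', -⟩ := profileThreshold_le hV hV3 hR hL
  have hr0 : 0 < r := hR.trans_le hr
  by_cases hrL : r < L
  · obtain ⟨hJ0, hJ⟩ := neumannFlux_outside_mem hV hV3 hR hVR hL ⟨hr, hrL.le⟩
    have hc1 := one_le_neumannNorm hV hV3 hR hVR hL
    have hc : 0 < neumannNorm V L := by linarith
    have hlam3 := neumannEigenvalue_mul_cube_le hV hV3 hR hVR hL'
    rw [neumannProfileDeriv, if_pos hrL]
    refine ⟨div_nonneg hJ0 (by positivity), ?_⟩
    rw [div_le_div_iff₀ (by positivity) (by positivity)]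
    calc neumannFlux V L r * (3 * r ^ 2) ≤ neumannEigenvalue V L * neumannNorm V L * L ^ 3 / 3 * (3 * r ^ 2) := by gcongr
      _ = neumannEigenvalue V L * L ^ 3 * (neumannNorm V L * r ^ 2) := by ring
      _ ≤ 5 * R * (neumannNorm V L * r ^ 2) := by gcongr
  · rw [neumannProfileDeriv, if_neg hrL]
    exact ⟨le_rfl, by positivity⟩

/-- **Lemma 2.1 (iii), second bound: `|∇w_ℓ(x)| ≤ C/(x² + 1)`**, explicitly
`|f_ℓ'(r)| ≤ ((K/6 + 1/8)(R² + 1) + 2(R + R⁻¹))/(r² + 1)` for all `r > 0` and `L ≥ L₀'`.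
[cite: BastiCenatiempoSchlein2021, Lemma 2.1 (iii); BoccatoEtAl2019, Lemma 4.1 (iii) (4.7)] -/
theorem abs_neumannProfileDeriv_le {L : ℝ} (hL : profileThreshold V R ≤ L) {r : ℝ} (hr : 0 < r) :
    |neumannProfileDeriv V L r| ≤ ((radialL3 V / 6 + 1 / 8) * (R ^ 2 + 1) + 2 * (R + R⁻¹)) / (r ^ 2 + 1) := by
  have hK := radialL3_nonneg (V := V)
  have hA : 0 ≤ (radialL3 V / 6 + 1 / 8) * (R ^ 2 + 1) := by positivity
  have hB : 0 ≤ 2 * (R + R⁻¹) := by positivity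
  rw [le_div_iff₀ (by positivity)]
  rcases le_or_gt r R with hrR | hrR
  · have h := abs_neumannProfileDeriv_inside_le hV hV3 hR hVR hL ⟨hr, hrR⟩
    have hr2 : r ^ 2 + 1 ≤ R ^ 2 + 1 := by nlinarith
    calc |neumannProfileDeriv V L r| * (r ^ 2 + 1) ≤ (radialL3 V / 6 + 1 / 8) * (R ^ 2 + 1) :=
          mul_le_mul h hr2 (by positivity) (by positivity)
      _ ≤ _ := le_add_of_nonneg_right hB
  · obtain ⟨h0, h⟩ := neumannProfileDeriv_outside_mem hV hV3 hR hVR hL hrR.le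
    rw [abs_of_nonneg h0]
    have h2 : neumannProfileDeriv V L r * (r ^ 2 + 1) ≤ 5 * R / 3 * (1 + (r ^ 2)⁻¹) := by
      have e : 5 * R / (3 * r ^ 2) * (r ^ 2 + 1) = 5 * R / 3 * (1 + (r ^ 2)⁻¹) := by
        field_simp
      rw [← e]
      exact mul_le_mul_of_nonneg_right h (by positivity)
    have h3 : (r ^ 2)⁻¹ ≤ (R ^ 2)⁻¹ := by
      rw [inv_le_inv₀ (by positivity) (by positivity)]; nlinarith
    have h5 : 5 * R / 3 * (1 + (r ^ 2)⁻¹) ≤ 5 * R / 3 * (1 + (R ^ 2)⁻¹) := by gcongr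
    have e : 5 * R / 3 * (1 + (R ^ 2)⁻¹) = 5 / 3 * (R + R⁻¹) := by
      field_simp
    have h6 : 0 ≤ R + R⁻¹ := by positivity
    rw [e] at h5
    linarith [h2, h5]

/-- **Lemma 2.1 (ii), second half: `∫ V f_ℓ = 8π𝔞 + O(𝔞²/ℓ)`**, in radial form with an explicit
constant: `|∫₀^∞ s²V(s)f_ℓ(s) ds - 2a| ≤ 18R²/L` for `L ≥ L₀'`, `a = volterraScatteringLength V R`
(so that `|∫_{ℝ³} V(x)f_ℓ(x) dx - 8πa| ≤ 72πR²/L`): `∫₀^∞ s²Vf_ℓ = c⁻¹∫₀ᴸ sVm_λ = 2λI/c` by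
`integral_pot_ground_eq`, and `|λI/c - a| ≤ 9R²/L` (`abs_flux_ratio_sub_scatteringLength_le`).
[cite: BastiCenatiempoSchlein2021, Lemma 2.1 (ii); BoccatoEtAl2019, Lemma 4.1 (ii) (4.6), App. B] -/
theorem abs_integral_sq_pot_neumannProfile_sub_le {L : ℝ} (hL : profileThreshold V R ≤ L) :
    |(∫ s in Ioi (0 : ℝ), s ^ 2 * ((V s).toReal * neumannProfile V L s)) - 2 * volterraScatteringLength V R| ≤
      18 * R ^ 2 / L := by
  obtain ⟨hL', -⟩ := profileThreshold_le hV hV3 hR hL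
  have hD1 := one_le_sub_of_threshold hL'
  have hRL : R ≤ L := by linarith
  have hL0 : 0 < L := by linarith
  have hc1 := one_le_neumannNorm hV hV3 hR hVR hL
  have hc : 0 < neumannNorm V L := by linarith
  have hmain := abs_flux_ratio_sub_scatteringLength_le hV hV3 hR hVR hL
  have hflux := integral_pot_ground_eq hV hV3 hR hVR hL'
  -- reduce the integral to `(0, L]` and to `c⁻¹ ∫₀ᴸ sVm_λ`
  have h1 : ∫ s in Ioi (0 : ℝ), s ^ 2 * ((V s).toReal * neumannProfile V L s) =
      ∫ s in Ioc 0 L, s ^ 2 * ((V s).toReal * neumannProfile V L s) := by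
    refine setIntegral_eq_of_subset_of_forall_sdiff_eq_zero measurableSet_Ioi Ioc_subset_Ioi_self fun s hs => ?_
    have hsL : L < s := by
      rcases hs with ⟨hs0, hs1⟩
      by_contra h
      exact hs1 ⟨hs0, not_lt.1 h⟩
    simp [hVR s (hRL.trans_lt hsL)]
  have h2 : ∫ s in Ioc 0 L, s ^ 2 * ((V s).toReal * neumannProfile V L s) =
      (neumannNorm V L)⁻¹ * ∫ s in Ioc 0 L, s * ((V s).toReal * volterraSol (neumannCoeff V (neumannEigenvalue V L)) s) := by
    rw [← integral_const_mul]
    refine setIntegral_congr_fun measurableSet_Ioc fun s hs => ?_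
    have hs0 : s ≠ 0 := hs.1.ne'
    have hc0 : neumannNorm V L ≠ 0 := hc.ne'
    rw [neumannProfile_of_mem hs]
    field_simp
  rw [h1, h2, hflux]
  have e : (neumannNorm V L)⁻¹ * (2 * neumannEigenvalue V L *
        ∫ s in Ioc 0 L, s * volterraSol (neumannCoeff V (neumannEigenvalue V L)) s) - 2 * volterraScatteringLength V R =
      2 * (neumannEigenvalue V L * (∫ s in Ioc 0 L, s * volterraSol (neumannCoeff V (neumannEigenvalue V L)) s) /
        (volterraSol (neumannCoeff V (neumannEigenvalue V L)) L / L) - volterraScatteringLength V R) := by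
    simp only [neumannNorm]
    ring
  rw [e, abs_mul, abs_two]
  calc 2 * |neumannEigenvalue V L * (∫ s in Ioc 0 L, s * volterraSol (neumannCoeff V (neumannEigenvalue V L)) s) /
        (volterraSol (neumannCoeff V (neumannEigenvalue V L)) L / L) - volterraScatteringLength V R|
      ≤ 2 * (9 * R ^ 2 / L) := by gcongr
    _ = 18 * R ^ 2 / L := by ring

/-- **[BastiCenatiempoSchlein2021, Lemma 2.1 (ii)–(iii)] for the radial Neumann ground state,
qualitative form.** For a measurable radial profile `V : ℝ → [0, ∞]` of range `R > 0` with
`∫₀^∞ V³s² < ∞` there are `L₀` and `C ≥ 0` (depending only on `V` and `R`) such that for every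
`L ≥ L₀` the profile `f = neumannProfile V L` satisfies: `f = 1` on `[L, ∞)`; `0 ≤ f ≤ 1`;
`|∫₀^∞ s²V f - 2a| ≤ C/L` with `a = volterraScatteringLength V R`; `0 ≤ 1 - f(r) ≤ C/(r + 1)`
for `r ≥ 0`; and `f` is differentiable on `(0, ∞)` with `|f'(r)| ≤ C/(r² + 1)`. (The explicit
versions are `neumannProfile_of_ge`, `neumannProfile_mem_Icc`,
`abs_integral_sq_pot_neumannProfile_sub_le`, `one_sub_neumannProfile_mem`,
`hasDerivAt_neumannProfile`, `abs_neumannProfileDeriv_le`.)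
[cite: BastiCenatiempoSchlein2021, Lemma 2.1 (ii)–(iii); BoccatoEtAl2019, Lemma 4.1 (ii)–(iii), (4.6)–(4.7)] -/
theorem neumannProfile_spec :
    ∃ L₀ C : ℝ, 0 ≤ C ∧ ∀ L, L₀ ≤ L →
      (∀ r, L ≤ r → neumannProfile V L r = 1) ∧
      (∀ r, neumannProfile V L r ∈ Icc 0 1) ∧
      |(∫ s in Ioi (0 : ℝ), s ^ 2 * ((V s).toReal * neumannProfile V L s)) - 2 * volterraScatteringLength V R| ≤
          C / L ∧
      (∀ r, 0 ≤ r → 0 ≤ 1 - neumannProfile V L r ∧ 1 - neumannProfile V L r ≤ C / (r + 1)) ∧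
      (∀ r, 0 < r → HasDerivAt (neumannProfile V L) (neumannProfileDeriv V L r) r ∧
        |neumannProfileDeriv V L r| ≤ C / (r ^ 2 + 1)) := by
  have hK := radialL3_nonneg (V := V)
  have hD0 : 0 ≤ (radialL3 V / 6 + 1 / 8) * (R ^ 2 + 1) + 2 * (R + R⁻¹) := by positivity
  refine ⟨profileThreshold V R, 18 * R ^ 2 + (2 * R + 1) + ((radialL3 V / 6 + 1 / 8) * (R ^ 2 + 1) + 2 * (R + R⁻¹)),
    by positivity, fun L hL => ?_⟩
  obtain ⟨hL', -⟩ := profileThreshold_le hV hV3 hR hL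
  have hD1 := one_le_sub_of_threshold hL'
  have hL0 : 0 < L := by linarith
  have hR2 : 0 ≤ 18 * R ^ 2 := by positivity
  refine ⟨fun r hr => neumannProfile_of_ge hV hV3 hR hVR hL' hr, neumannProfile_mem_Icc hV hV3 hR hVR hL, ?_, ?_, ?_⟩
  · exact (abs_integral_sq_pot_neumannProfile_sub_le hV hV3 hR hVR hL).trans
      (div_le_div_of_nonneg_right (by linarith) hL0.le)
  · intro r hr
    obtain ⟨h0, h1⟩ := one_sub_neumannProfile_mem hV hV3 hR hVR hL hr
    exact ⟨h0, h1.trans (div_le_div_of_nonneg_right (by linarith) (by linarith))⟩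
  · intro r hr
    exact ⟨hasDerivAt_neumannProfile hV hV3 hR hVR hL' hr, (abs_neumannProfileDeriv_le hV hV3 hR hVR hL hr).trans
      (div_le_div_of_nonneg_right (by linarith) (by positivity))⟩

end Profile

/-! ### `a = scatteringLength V`: identification with the tree's variational scattering length -/

section ScatteringLength

variable {V : ℝ → ℝ≥0∞} {R : ℝ}
variable (hV : Measurable V) (hV3 : ∫⁻ s in Ioi (0 : ℝ), ENNReal.ofReal (s ^ 2) * V s ^ 3 ≠ ⊤)
include hV hV3

/-- A radial `L³` profile is finite a.e. on `(0, ∞)`. [folklore] -/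
theorem ae_lt_top_of_radialL3 : ∀ᵐ s ∂(volume.restrict (Ioi (0 : ℝ))), V s < ⊤ := by
  have hmeas : AEMeasurable (fun s => ENNReal.ofReal (s ^ 2) * V s ^ 3) (volume.restrict (Ioi (0 : ℝ))) :=
    ((ENNReal.measurable_ofReal.comp (measurable_id.pow_const 2)).mul (hV.pow_const 3)).aemeasurable
  filter_upwards [ae_lt_top' hmeas hV3, ae_restrict_mem measurableSet_Ioi] with s hs hs0
  have hs2 : ENNReal.ofReal (s ^ 2) ≠ 0 := by
    rw [← pos_iff_ne_zero, ENNReal.ofReal_pos]; exact pow_pos hs0 2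
  have h3 : V s ^ 3 ≠ ⊤ := by
    intro h
    rw [h, ENNReal.mul_top hs2] at hs
    exact lt_irrefl _ hs
  refine lt_top_iff_ne_top.2 fun h => h3 ?_
  rw [h]; simp

omit hV in
/-- The truncations `V_N = min(V, N)` are radial `L³` profiles. [folklore] -/
theorem radialL3_trunc_ne_top (N : ℕ) :
    ∫⁻ s in Ioi (0 : ℝ), ENNReal.ofReal (s ^ 2) * truncPotential V N s ^ 3 ≠ ⊤ :=
  ne_top_of_le_ne_top hV3 (lintegral_mono fun s => by gcongr; exact truncPotential_le V N s)

/-- **The truncation error of the coefficient vanishes**: `∫₀ᵀ s|½min(V,N) - ½V| ds → 0`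
(dominated convergence: `V < ∞` a.e., `min(V, N) = V` eventually, domination by `sV`). [folklore] -/
theorem tendsto_integral_trunc_sub (T : ℝ) :
    Tendsto (fun N : ℕ => ∫ s in Ioc 0 T, s * |neumannCoeff (truncPotential V N) 0 s - neumannCoeff V 0 s|)
      atTop (𝓝 0) := by
  have hae : ∀ᵐ s ∂(volume.restrict (Ioc (0 : ℝ) T)), V s < ⊤ :=
    ae_restrict_of_ae_restrict_of_subset Ioc_subset_Ioi_self (ae_lt_top_of_radialL3 hV hV3)
  have hlim : ∀ᵐ s ∂(volume.restrict (Ioc (0 : ℝ) T)),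
      Tendsto (fun N : ℕ => s * |neumannCoeff (truncPotential V N) 0 s - neumannCoeff V 0 s|) atTop (𝓝 0) := by
    filter_upwards [hae] with s hs
    obtain ⟨N₀, hN₀⟩ := ENNReal.exists_nat_gt hs.ne
    refine tendsto_const_nhds.congr' ?_
    filter_upwards [eventually_ge_atTop N₀] with N hN
    have hNN : (N₀ : ℝ≥0∞) ≤ N := by exact_mod_cast hN
    have : truncPotential V N s = V s := by
      rw [truncPotential, min_eq_left (hN₀.le.trans hNN)]
    simp [neumannCoeff, this]
  have hbound : ∀ N : ℕ, ∀ᵐ s ∂(volume.restrict (Ioc (0 : ℝ) T)),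
      ‖s * |neumannCoeff (truncPotential V N) 0 s - neumannCoeff V 0 s|‖ ≤ s * (V s).toReal := by
    intro N
    filter_upwards [hae, ae_restrict_mem measurableSet_Ioc] with s hs hs0
    rw [Real.norm_eq_abs, abs_mul, abs_abs, abs_of_nonneg hs0.1.le]
    refine mul_le_mul_of_nonneg_left ?_ hs0.1.le
    simp only [neumannCoeff, sub_zero]
    have h1 : (truncPotential V N s).toReal ≤ (V s).toReal := ENNReal.toReal_mono hs.ne (truncPotential_le V N s)
    have h2 : 0 ≤ (truncPotential V N s).toReal := ENNReal.toReal_nonneg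
    rw [abs_le]; constructor <;> linarith
  have hmeas : ∀ N : ℕ, AEStronglyMeasurable
      (fun s => s * |neumannCoeff (truncPotential V N) 0 s - neumannCoeff V 0 s|) (volume.restrict (Ioc (0 : ℝ) T)) :=
    fun N => (measurable_id.mul (continuous_abs.measurable.comp ((measurable_neumannCoeff (measurable_truncPotential hV N) 0).sub
      (measurable_neumannCoeff hV 0)))).aestronglyMeasurable
  have h := tendsto_integral_of_dominated_convergence (fun s => s * (V s).toReal) hmeas
    (integrableOn_id_mul_pot hV hV3 T) hbound hlim
  simpa using h

/-- The weight of a truncation is dominated by the weight of `V`: `G_{V_N}(T) ≤ G_V(T)`. [folklore] -/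
theorem volterraWeight_trunc_le (N : ℕ) (T : ℝ) :
    volterraWeight (neumannCoeff (truncPotential V N) 0) T ≤ volterraWeight (neumannCoeff V 0) T := by
  have hae : ∀ᵐ s ∂(volume.restrict (Ioc (0 : ℝ) T)), V s < ⊤ :=
    ae_restrict_of_ae_restrict_of_subset Ioc_subset_Ioi_self (ae_lt_top_of_radialL3 hV hV3)
  have hI := integrableOn_id_mul_neumannCoeff hV hV3 0 T
  have hIN := integrableOn_id_mul_neumannCoeff (measurable_truncPotential hV N) (radialL3_trunc_ne_top hV3 N) 0 T
  unfold volterraWeight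
  refine integral_mono_ae (integrableOn_posPart_mul_abs hIN) (integrableOn_posPart_mul_abs hI) ?_
  filter_upwards [hae] with s hs
  refine mul_le_mul_of_nonneg_left ?_ (le_max_right _ _)
  simp only [neumannCoeff, sub_zero]
  have h1 : (truncPotential V N s).toReal ≤ (V s).toReal := ENNReal.toReal_mono hs.ne (truncPotential_le V N s)
  have h2 : 0 ≤ (truncPotential V N s).toReal := ENNReal.toReal_nonneg
  rw [abs_of_nonneg (by positivity), abs_of_nonneg (by positivity)]
  linarith

/-- **Continuity of the zero-energy data under truncation**: `m_{V_N}(R) → m_V(R)` and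
`m'_{V_N}(R) → m'_V(R)` for `V_N = min(V, N)` (Lipschitz dependence on the coefficient,
`RadialVolterraEquation.lean`). [folklore] -/
theorem tendsto_zeroEnergy_data_trunc {R : ℝ} (hR : 0 ≤ R) :
    Tendsto (fun N : ℕ => volterraSol (neumannCoeff (truncPotential V N) 0) R) atTop
        (𝓝 (volterraSol (neumannCoeff V 0) R)) ∧
      Tendsto (fun N : ℕ => volterraDeriv (neumannCoeff (truncPotential V N) 0) R) atTop
        (𝓝 (volterraDeriv (neumannCoeff V 0) R)) := by
  have hI := integrableOn_id_mul_neumannCoeff hV hV3 0 R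
  have hIN := fun N : ℕ => integrableOn_id_mul_neumannCoeff (measurable_truncPotential hV N) (radialL3_trunc_ne_top hV3 N) 0 R
  have hGN := fun N : ℕ => volterraWeight_trunc_le hV hV3 N R
  have hδ := tendsto_integral_trunc_sub hV hV3 R
  set G := volterraWeight (neumannCoeff V 0) R with hG
  have hRR : R ∈ Icc 0 R := ⟨hR, le_rfl⟩
  constructor
  · -- `|m_N(R) - m(R)| ≤ e^G δ_N (R e^{G_N(R)}) ≤ (e^G R e^G) δ_N`
    refine tendsto_iff_norm_sub_tendsto_zero.2 (squeeze_zero_norm' (Eventually.of_forall fun N => ?_)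
      (by simpa using hδ.const_mul (Real.exp G * (R * Real.exp G))))
    rw [norm_norm, Real.norm_eq_abs]
    have h := abs_volterraSol_sub_volterraSol_le (hIN N) hI hRR
    refine h.trans ?_
    have hδ0 : 0 ≤ ∫ s in Ioc 0 R, s * |neumannCoeff (truncPotential V N) 0 s - neumannCoeff V 0 s| :=
      setIntegral_nonneg measurableSet_Ioc fun s hs => mul_nonneg hs.1.le (abs_nonneg _)
    have h1 : R * Real.exp (volterraWeight (neumannCoeff (truncPotential V N) 0) R) ≤ R * Real.exp G :=
      mul_le_mul_of_nonneg_left (Real.exp_le_exp.2 (hGN N)) hR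
    calc Real.exp G * (∫ s in Ioc 0 R, s * |neumannCoeff (truncPotential V N) 0 s - neumannCoeff V 0 s|) *
          (R * Real.exp (volterraWeight (neumannCoeff (truncPotential V N) 0) R))
        ≤ Real.exp G * (∫ s in Ioc 0 R, s * |neumannCoeff (truncPotential V N) 0 s - neumannCoeff V 0 s|) *
          (R * Real.exp G) := by gcongr
      _ = Real.exp G * (R * Real.exp G) *
          ∫ s in Ioc 0 R, s * |neumannCoeff (truncPotential V N) 0 s - neumannCoeff V 0 s| := by ring
  · refine tendsto_iff_norm_sub_tendsto_zero.2 (squeeze_zero_norm' (Eventually.of_forall fun N => ?_)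
      (by simpa using hδ.const_mul (Real.exp G * (1 + G * Real.exp G))))
    rw [norm_norm, Real.norm_eq_abs]
    have h := abs_volterraDeriv_sub_volterraDeriv_le (hIN N) hI hRR
    refine h.trans ?_
    have hδ0 : 0 ≤ ∫ s in Ioc 0 R, s * |neumannCoeff (truncPotential V N) 0 s - neumannCoeff V 0 s| :=
      setIntegral_nonneg measurableSet_Ioc fun s hs => mul_nonneg hs.1.le (abs_nonneg _)
    have hG0N : 0 ≤ volterraWeight (neumannCoeff (truncPotential V N) 0) R :=
      setIntegral_nonneg measurableSet_Ioc fun s _ => mul_nonneg (le_max_right _ _) (abs_nonneg _)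
    have h1 : 1 + volterraWeight (neumannCoeff (truncPotential V N) 0) R *
        Real.exp (volterraWeight (neumannCoeff (truncPotential V N) 0) R) ≤ 1 + G * Real.exp G := by
      have := hGN N
      have hG0 : 0 ≤ G := hG0N.trans this
      gcongr
    calc Real.exp G * (∫ s in Ioc 0 R, s * |neumannCoeff (truncPotential V N) 0 s - neumannCoeff V 0 s|) *
          (1 + volterraWeight (neumannCoeff (truncPotential V N) 0) R *
            Real.exp (volterraWeight (neumannCoeff (truncPotential V N) 0) R))
        ≤ Real.exp G * (∫ s in Ioc 0 R, s * |neumannCoeff (truncPotential V N) 0 s - neumannCoeff V 0 s|) *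
          (1 + G * Real.exp G) := by gcongr
      _ = Real.exp G * (1 + G * Real.exp G) *
          ∫ s in Ioc 0 R, s * |neumannCoeff (truncPotential V N) 0 s - neumannCoeff V 0 s| := by ring

variable (hR : 0 < R) (hVR : ∀ r, R < r → V r = 0)
include hR hVR

omit hVR in
/-- **The radial scattering lengths of the truncations converge**: `a(V_N) → a` with
`a(W) = R - m_W(R)/m_W'(R)` (`m_V'(R) ≥ 1`). [cite: LSSY2005, App. C, Thm. C.1] -/
theorem tendsto_volterraScatteringLength_trunc :
    Tendsto (fun N : ℕ => volterraScatteringLength (truncPotential V N) R) atTop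
      (𝓝 (volterraScatteringLength V R)) := by
  obtain ⟨h1, h2⟩ := tendsto_zeroEnergy_data_trunc hV hV3 hR.le
  have hα₀ := (zeroEnergy_data_bounds hV hV3 hR).1
  simp only [volterraScatteringLength]
  exact tendsto_const_nhds.sub (h1.div h2 (by linarith))

/-- **`a = scatteringLength V`.** For a measurable radial profile `V ≥ 0` of finite range with
`∫₀^∞ V³s² < ∞` and `∫_{ℝ³} V(|x|) dx < ∞`, the radial scattering length
`a = R - u(R)/u'(R)` of the Volterra theory (`volterraScatteringLength`) is the tree's variational
scattering length `scatteringLength V` of [LSSY2005, Thm. C.1] (`4π𝔞 = inf ∫|∇φ|² + ½V|φ|²`):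
both are the limit of the ODE scattering lengths of the bounded truncations `min(V, N)`
(`toReal_scatteringLength_eq_iSup`, `odeScatteringLength_eq_volterra`, and the continuity above).
[cite: LSSY2005, App. C, Thm. C.1 and (2.5); BoccatoEtAl2019, (4.4)–(4.6)] -/
theorem volterraScatteringLength_eq_toReal_scatteringLength (hint : (∫⁻ x : Space, V ‖x‖) ≠ ⊤) :
    volterraScatteringLength V R = (scatteringLength V).toReal := by
  have hN : ∀ N : ℕ, odeScatteringLength (truncPotential V N) R = volterraScatteringLength (truncPotential V N) R := by
    intro N
    rw [odeScatteringLength_eq_volterra (measurable_truncPotential hV N) (truncPotential_le_ofReal V N)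
      (Nat.cast_nonneg _) hR.le, volterraScatteringLength]
    have : neumannCoeff (truncPotential V N) 0 = fun s => (truncPotential V N s).toReal / 2 := by
      funext s; simp [neumannCoeff]
    rw [this]
  have hlim' := tendsto_odeScatteringLength_trunc hV hR hVR
  rw [toReal_scatteringLength_eq_iSup hV hR hVR hint]
  simp_rw [hN] at hlim' ⊢
  exact (tendsto_nhds_unique hlim' (tendsto_volterraScatteringLength_trunc hV hV3 hR)).symm

/-- **Lemma 2.1 (i) with the tree's scattering length**: `|λ_ℓ - 3𝔞/L³| ≤ 55R²/L⁴` for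
`L ≥ L₀`, `𝔞 = scatteringLength V`. [cite: BastiCenatiempoSchlein2021, Lemma 2.1 (i); BoccatoEtAl2019, Lemma 4.1 (i) (4.5)] -/
theorem abs_neumannEigenvalue_sub_scatteringLength_le (hint : (∫⁻ x : Space, V ‖x‖) ≠ ⊤) {L : ℝ}
    (hL : neumannThreshold V R ≤ L) :
    |neumannEigenvalue V L - 3 * (scatteringLength V).toReal / L ^ 3| ≤ 55 * R ^ 2 / L ^ 4 := by
  rw [← volterraScatteringLength_eq_toReal_scatteringLength hV hV3 hR hVR hint]
  exact (abs_neumannEigenvalue_sub_le hV hV3 hR hVR hL).1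

/-- **Lemma 2.1 (ii) with the tree's scattering length**: `|∫₀^∞ s²Vf_ℓ - 2𝔞| ≤ 18R²/L` for
`L ≥ L₀'`, `𝔞 = scatteringLength V` (i.e. `|∫_{ℝ³} Vf_ℓ - 8π𝔞| ≤ 72πR²/L`).
[cite: BastiCenatiempoSchlein2021, Lemma 2.1 (ii); BoccatoEtAl2019, Lemma 4.1 (ii) (4.6)] -/
theorem abs_integral_sq_pot_neumannProfile_sub_scatteringLength_le (hint : (∫⁻ x : Space, V ‖x‖) ≠ ⊤) {L : ℝ}
    (hL : profileThreshold V R ≤ L) :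
    |(∫ s in Ioi (0 : ℝ), s ^ 2 * ((V s).toReal * neumannProfile V L s)) - 2 * (scatteringLength V).toReal| ≤
      18 * R ^ 2 / L := by
  rw [← volterraScatteringLength_eq_toReal_scatteringLength hV hV3 hR hVR hint]
  exact abs_integral_sq_pot_neumannProfile_sub_le hV hV3 hR hVR hL

end ScatteringLength


end Literature.MathematicalPhysics.QuantumManyBody.BoseGas
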